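import Literature.Analysis.InnerProduct.EvenSphereHeatTraceExpansion
import Literature.Analysis.InnerProduct.OddRealProjectiveSpaceHeatTraceExpansion
import HarnessLib

/-!
# The hemispheres `S^{2m}_±` of EVERY even-dimensional round sphere, Dirichlet and Neumann, to all orders:
# `Z_{D/N}(t) = ½Z_{S^{2m}}(t) ∓ ½E_m(t)`, `E_m(t) = ∑_K C(K+2m−2, 2m−2)e^{−tK(K+2m−1)} =
# (2m−1)e^{(2m−1)²t/4}∑_{i<m} p_{m,i}·½·4ⁱΓ(i+½)t^{−(i+½)} + O(t^∞)` — integer powers from the sphere, HALF-INTEGER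
# powers from the boundary (McKean–Singer's `±¼√(4πt)·area(∂)` and all its successors), Weyl, `ζ_D(0) = ½A_{m,m}`,
# `ζ_N(0) = ½A_{m,m} − 1`, the boundary poles `s = m − ½, m − 3/2, …` (top residue `∓1/(4(2m−2)!)`)

Layer `Literature/Analysis/InnerProduct`, namespace `Literature.Analysis.InnerProduct`; sequel BY IMPORT of row g41-#2
(`EvenSphereHeatTraceExpansion.lean`, the closed spheres `S^{2m}`: REUSED `evenSphere_multiplicity_eq` (`d(l) = u·p_m(u²)`),
`prod_range_two_mul_eq`, `eval_evenSphere_poly_eq_zero`, `natDegree_evenSphere_poly`, `coeff_evenSphere_poly_top`,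
`hasSum_evenSphere_multiplicity`, `tsum_evenSphere`, `tendsto_natCast_mul_add_sub_one_atTop`,
`isBigO_evenSphere_heatTrace_expansion` (THE expansion of `S^{2m}`), `evenSphere_heatCoeff_zero`, `evenSphere_poly_one/two`) and
of row g39-#3 (`OddRealProjectiveSpaceHeatTraceExpansion.lean`: REUSED the even-weight theta tool on the odd integers
`isBigO_tsum_nat_eval_sq_two_mul_add_one_sub` — `∑_{j≥0} p((2j+1)²)e^{−t(2j+1)²} − ¼∑ᵢ pᵢΓ(i+½)t^{−(i+½)} = O(t^β)` for every
real polynomial `p` and every `β` — and `hasSum_nat_eval_sq_two_mul_add_one_mul_exp`); the generic family lemmas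
`hasSum_sigma_fin_of_hasSum_natCast_mul`, `tendsto_sigma_fin_cofinite_atTop`, `ncard_setOf_sigma_fin_eq` of row g39-#2 and the
abstract theory (`HeatTraceExpansionConsequences.lean`, `HeatTraceZetaContinuation.lean`, `HeatTraceZetaRegularity.lean`) do
the rest. This is the every-`m` version of row g40-#3 (`HemisphereHeatTraceExpansion.lean`, `S²₊`), which it recovers for
`m = 1` (`evenHemisphere_one_boundaryCoeff`). Lane `lit-hodgefound` (Track 2 foundations library), prover seat
`lit-hodgefound-p06` (generation 41), self-proposed row g41-#3. THEOREMS ONLY (no definition, no instance, no notation, no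
named fact; the multiplicity polynomial `p_m = ∏_{i<m−1}(X − (2i+1)²)/(4^{m−1}(2m−1)!)` and the coefficients are written out).

## Sources, verbatim

P. Freitas, J. Mao, I. Salavessa, *Pólya-type inequalities on spheres and hemispheres*, Ann. Inst. Fourier (2025),
arXiv:2204.07277 (held text `paper:arxiv-2204.07277`). §2.2 "Eigenvalues of `S^n_+`" (chunk p0006): "The distinct eigenvalues
of `S^n_+` are given by (cf. [bb], [bsj]) `λ̄_K = K(K+n−1)`, `K = 1, 2, …`, with multiplicity
`m(K) = binom(n+K−2, n−1) = binom(n+K−2, K−1) = K^{\overline{n−1}}/(n−1)!`" — the DIRICHLET problem (the paper's `S^n_+`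
carries the Dirichlet condition; for `n = 2` this is the multiplicity `K` of row g40-#3). §2.1 (chunk p0005): "the distinct
closed eigenvalues are given by `λ̄_K = K(K+n−1)`, `K = 0, 1, 2, ⋯`, where the multiplicity of `λ̄_K` equal the dimension of
the space of homogeneous harmonic polynomials of degree `K`, that is, `m(K) = binom(n+K, n) − binom(n+K−2, n)`". §1.3
(chunk p0004): "Since the spectrum of `Sⁿ` consists of the union of the Dirichlet and Neumann spectra on `Sⁿ₊` …" — so the
NEUMANN multiplicity of `K(K+n−1)`, `K ≥ 0`, is `m_{Sⁿ}(K) − binom(n+K−2, n−1) = binom(n+K−1, n−1)` (Pascal; here with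
`n = 2m` and Kirsten's form `m_{S^{2m}}(K) = binom(K+2m−1, 2m−1) + binom(K+2m−2, 2m−1)` of row g41-#2:
`evenHemisphere_multiplicity_neumann_eq_add`).
H. P. McKean, I. M. Singer, *Curvature and the eigenvalues of the Laplacian*, J. Differential Geom. 1 (1967) 43–69, eq. (6)
p. 45 (quoted in row g40-#3 from the held page): "`(4πt)^{d/2} Z± = the (Riemannian) volume of D ± ¼√(4πt) × the
(Riemannian) surface area of B + (t/3) × the curvatura integra … − (t/6) × the integrated mean curvature … + O(t^{3/2})`"
(`Z⁻` Dirichlet, `Z⁺` Neumann). For `D = S^{2m}_+`, `B = S^{2m−1}` (a totally geodesic equator): `vol D = ½|S^{2m}|`,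
`area B = |S^{2m−1}| = 2π^m/Γ(m)`; the `±¼√(4πt)·area B` term is `±√π/(4^m(m−1)!)·t^{−m+½}`
(`evenHemisphere_boundaryCoeff_zero_eq_area`).
K. Kirsten, *Spectral Functions in Mathematics and Physics* (2001), §3.2 eqs. (3.2.19)–(3.2.20) (held text, p0058: "`d(l) =
(2l+d−1)(l+d−2)!/(l!(d−1)!)` … `d(l) = C(l+d−1, d−1) + C(l+d−2, d−1)`", `λ_l = l(l+d−1) = (l+(d−1)/2)² − ((d−1)/2)²`) and §4.2
(p0096: "with the volume `|S^d| = 2π^{(d+1)/2}/Γ((d+1)/2)` of the `d`-sphere").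
P. H. Bérard, *Spectral Geometry* (LNM 1207, 1986), Ch. V nº6 (ii) (theta series ∕ Poisson summation), Ch. VII nº1–nº2
(`Z(t) = ∑ exp(−λⱼt)`, `a₀ = Vol`), nº10 (ii) (Weyl's formula (11)).
P. B. Gilkey, *Invariance theory …* (2nd ed., 1995), §1.10 Lemma 1.10.1 (poles of `Γ(s)ζ(s,P)` at `s = (m−n)/d` with residues
`aₙ(P)Γ((m−n)/d)^{−1}`, regular values at `s = 0, −1, …`, the zero modes).

## The computation

(1) MULTIPLICITIES. `N(K) = C(K+2m−1, 2m−1)`, `D(K) = C(K+2m−2, 2m−1)`, `N(K) + D(K) = m_{S^{2m}}(K)` (literally the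
multiplicity of row g41-#2) and `N(K) − D(K) = C(K+2m−2, 2m−2) = (K+1)⋯(K+2m−2)/(2m−2)!`; pairing the factors around the
centre, `(K+1)⋯(K+2m−2) = ∏_{i<m−1}((K+m−½)² − (i+½)²) = 4^{−(m−1)}∏_{i<m−1}(u² − (2i+1)²)`, `u = 2K+2m−1`, so
`C(K+2m−2, 2m−2) = (2m−1)·p_m(u²)` with the polynomial `p_m(X) = ∏_{i<m−1}(X − (2i+1)²)/(4^{m−1}(2m−1)!)` of row g41-#2
(there `m_{S^{2m}}(K) = u·p_m(u²)`): the boundary weight is the EVEN polynomial `(2m−1)p_m(u²)` where the sphere's is the odd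
`u·p_m(u²)`. (2) THE BOUNDARY TRACE. `K(K+2m−1) = u²/4 − (2m−1)²/4` and `p_m((2n+1)²) = 0` for `n < m−1`, so
`E_m(t) := Z_N − Z_D = ∑_K C(K+2m−2,2m−2)e^{−tK(K+2m−1)} = (2m−1)e^{ct}∑_{n≥0} p_m((2n+1)²)e^{−(t/4)(2n+1)²}`,
`c = (2m−1)²/4`; by the tool of row g39-#3 read at `t/4`, `∑_{n≥0} p_m((2n+1)²)e^{−(t/4)(2n+1)²} =
∑_{i<m} p_{m,i}·½·4ⁱΓ(i+½)·t^{−(i+½)} + O(t^β)` for EVERY `β` (`¼Γ(i+½)(t/4)^{−(i+½)} = ½4ⁱΓ(i+½)t^{−(i+½)}`): PURE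
HALF-INTEGER POWERS, no `O(1)` part (the odd integers carry no constant term). Multiplying by `(2m−1)e^{ct} =
(2m−1)∑_a cᵃtᵃ/a!` (Cauchy product on `t^{m−½}·(…)`, a polynomial up to `O(t^∞)`):
`E_m(t) − ∑_{n≤m+N} B_{m,n} t^{n−m+½} = O(t^{N+3/2})`, `B_{m,n} = (2m−1)∑_{a+b=n, b<m} (cᵃ/a!)·p_{m,m−1−b}·½4^{m−1−b}Γ(m−b−½)`.
(3) `Z_D = ½(Z_{S^{2m}} − E_m)`, `Z_N = ½(Z_{S^{2m}} + E_m)` and row g41-#2 (`Z_{S^{2m}} − ∑_{n≤m+N} A_{m,n}t^{n−m} =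
O(t^{N+1})`): `Z_{D/N}(t) − ∑_{k ∈ Fin(m+N+1) ⊕ Fin(m+N+1)} [½A_{m,n}t^{n−m} | ∓½B_{m,n}t^{n−m+½}] = O(t^{N+1})`.
(4) CHECKS. `B_{m,0} = (2m−1)·p_{m,m−1}·½4^{m−1}Γ(m−½) = Γ(m−½)/(2(2m−2)!) = 2√π/(4^m(m−1)!)`, and `½B_{m,0} =
¼√(4π)·(4π)^{−m}·|S^{2m−1}|` (McKean–Singer); `m = 1`: `B_{1,n} = (√π/2)(¼)ⁿ/n!` (row g40-#3's `E(t) ∼ (√π/2)e^{t/4}t^{−½}`);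
`m = 2` (`S⁴_±`): `B_{2,0} = √π/8`, `B_{2,1} = 7√π/32`. (5) THE MACHINERY: Weyl `#{λ ≤ Λ}/Λ^m → ½A_{m,0}/Γ(m+1) =
½(m−1)!/((2m−1)!m!)` for both problems (`vol(S^{2m}_+) = ½vol(S^{2m})`); at `s = 0` only the exponent `0` counts (the
half-integers never vanish): `ζ_D(0) = ½A_{m,m}` (no zero mode: `D(0) = C(2m−2,2m−1) = 0`), `ζ_N(0) = ½A_{m,m} − 1`
(`N(0) = 1`); at `s = m − ½` only the exponent `−m+½`: `Res = Γ(m−½)^{−1}·(∓½B_{m,0}) = ∓1/(4(2m−2)!)` (`m = 1`: `∓¼`, row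
g40-#3).

## What is proved

* §1 `evenHemisphere_multiplicity_neumann_eq_add` (Pascal), **`evenHemisphere_boundary_multiplicity_eq`**
  (`C(K+2m−2,2m−2) = (2m−1)p_m(u²)`).
* §2 **`hasSum_evenHemisphere_boundary_multiplicity`** (`E_m = (2m−1)e^{ct}∑ p_m((2n+1)²)e^{−(t/4)(2n+1)²}`),
  `summable_evenHemisphere_boundary_multiplicity`, **`hasSum_dirichletEvenHemisphere_multiplicity`** (`Z_D = ½(Z_S − E_m)`),
  **`hasSum_neumannEvenHemisphere_multiplicity`**;
  the families on `Σ K, Fin D(K)` and `Σ K, Fin N(K)`: `hasSum_/summable_dirichletEvenHemisphere`,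
  `hasSum_/summable_neumannEvenHemisphere`, `tsum_dirichletEvenHemisphere_add_tsum_neumannEvenHemisphere` (`= Z_{S^{2m}}`),
  `tsum_neumannEvenHemisphere_sub_tsum_dirichletEvenHemisphere` (`= E_m`), `tendsto_dirichlet/neumannEvenHemisphere_cofinite_atTop`,
  `ncard_setOf_dirichletEvenHemisphere_eq_zero` (`0`), `ncard_setOf_neumannEvenHemisphere_eq_zero` (`1`); private
  `natCast_mul_add_sub_one_eq_zero_iff`.
* §3 **`isBigO_evenSphereBoundaryTheta_sub`** (the tool at `t/4`, every `β`), **`isBigO_evenHemisphere_boundary_expansion`**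
  (`E_m` to all orders, half-integer powers), **`isBigO_neumannEvenHemisphere_sub_dirichletEvenHemisphere`** (`Z_N − Z_D` in
  closed form up to `O(t^∞)`), **`isBigO_dirichletEvenHemisphere_heatTrace_expansion`**,
  **`isBigO_neumannEvenHemisphere_heatTrace_expansion`** (THE EXPANSIONS, machinery format `κ = Fin(m+N+1) ⊕ Fin(m+N+1)`,
  `β = N+1`); private `tendsto_div_four_nhdsGT`, `isBigO_eval_sub_sum_coeff`, `isBigO_exp_const_mul_sub_sum`,
  `isBigO_exp_mul_sub_sum_antidiagonal` (copies of row g41-#2's private helpers), `isBigO_half_evenSphere_add_mul_boundary_sub`.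
* §4 **`evenHemisphere_boundaryCoeff_zero`** (`B_{m,0} = 2√π/(4^m(m−1)!)`), **`evenHemisphere_boundaryCoeff_zero_eq_area`**
  (McKEAN–SINGER's `¼√(4π)(4π)^{−m}|S^{2m−1}|`), `evenHemisphere_one_boundaryCoeff` (`m = 1`: row g40-#3),
  `evenHemisphere_two_boundaryCoeff` (`S⁴_±`: `√π/8`, `7√π/32`); private `coeff_evenSphere_poly_two_one/zero`.
* §5 **`tendsto_pow_mul_dirichlet/neumannEvenHemisphere_heatTrace`** (`t^mZ → ½(m−1)!/(2m−1)!`),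
  **`tendsto_ncard_dirichlet/neumannEvenHemisphere_le_div_rpow`** (WEYL), **`tendsto_dirichletEvenHemisphereZeta_continuation_nhdsNE_zero`**
  (`ζ_D(0) = ½A_{m,m}`), **`tendsto_neumannEvenHemisphereZeta_continuation_nhdsNE_zero`** (`ζ_N(0) = ½A_{m,m} − 1`),
  **`tendsto_sub_mul_dirichlet/neumannEvenHemisphereZeta_continuation_top`** (residues `∓1/(4(2m−2)!)` at `s = m − ½`);
  private `evenHemisphereExponent_eq_iff`, `evenHemisphereHalfExponent_eq_iff`, `natCast_sub_add_half_ne_intCast/_neg/_zero`,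
  `natCast_sub_ne_neg_sub_half`, `natCast_sub_half_ne_zero`, `inv_Gamma_mul_sqrt_pi_div` (`Γ(m−½)^{−1}√π/(4^m(m−1)!) =
  1/(4(2m−2)!)`).

## References

* [FreitasMaoSalavessa2025] P. Freitas, J. Mao, I. Salavessa, *Pólya-type inequalities on spheres and hemispheres*, Ann. Inst.
  Fourier (2025), arXiv:2204.07277, §1.3, §2.1, §2.2.
* [McKeanSinger1967] H. P. McKean, I. M. Singer, *Curvature and the eigenvalues of the Laplacian*, J. Differential Geom. 1
  (1967) 43–69, eq. (6) p. 45.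
* [Kirsten2001] K. Kirsten, *Spectral Functions in Mathematics and Physics*, Chapman & Hall/CRC (2001), §3.2 eqs.
  (3.2.19)–(3.2.20), §4.2.
* [Berard1986] P. H. Bérard, *Spectral Geometry: Direct and Inverse Problems*, LNM 1207, Springer (1986), Ch. V nº6 (ii),
  Ch. VII nº1, nº2, nº10 (ii).
* [Gilkey1995] P. B. Gilkey, *Invariance theory, the heat equation, and the Atiyah–Singer index theorem*, 2nd ed., CRC Press
  (1995), §1.10 Lemma 1.10.1.
-/

noncomputable section

open Real Filter Topology Set Asymptotics Polynomial

namespace Literature.Analysis.InnerProduct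

/-! ### §1 The multiplicities: `N(K) = D(K) + C(K+2m−2, 2m−2)`, `C(K+2m−2, 2m−2) = (2m−1)·p_m(u²)`, `u = 2K+2m−1` -/

/-- **Pascal on the hemisphere multiplicities**: `C(K+2m−1, 2m−1) = C(K+2m−2, 2m−1) + C(K+2m−2, 2m−2)` — the Neumann
multiplicity is the Dirichlet one plus the dimension `C(K+2m−2, 2m−2)` of the degree-`K` polynomials on the equator `ℝ^{2m−1}`;
with row g41-#2's `m_{S^{2m}}(K) = C(K+2m−1,2m−1) + C(K+2m−2,2m−1)` this is "the spectrum of `Sⁿ` consists of the union of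
the Dirichlet and Neumann spectra on `Sⁿ₊`". [cite: FreitasMaoSalavessa2025, §1.3 and §2.2 (`m(K) = binom(n+K−2, n−1)`)] -/
theorem evenHemisphere_multiplicity_neumann_eq_add (m : ℕ) (hm : 1 ≤ m) (l : ℕ) :
    (l + 2 * m - 1).choose (2 * m - 1) = (l + 2 * m - 2).choose (2 * m - 1) + (l + 2 * m - 2).choose (2 * m - 2) := by
  obtain ⟨M, rfl⟩ : ∃ M, m = M + 1 := ⟨m - 1, by omega⟩
  rw [show l + 2 * (M + 1) - 1 = (l + 2 * M) + 1 by omega, show 2 * (M + 1) - 1 = 2 * M + 1 by omega,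
    show l + 2 * (M + 1) - 2 = l + 2 * M by omega, show 2 * (M + 1) - 2 = 2 * M by omega, Nat.choose_succ_succ']
  ring

/-- **THE BOUNDARY WEIGHT IS AN EVEN POLYNOMIAL IN `u = 2K+2m−1`: `C(K+2m−2, 2m−2) = (2m−1)·p_m(u²)`**,
`p_m(X) = ∏_{i<m−1}(X − (2i+1)²)/(4^{m−1}(2m−1)!)` (`(2m−2)!·C(K+2m−2,2m−2) = (K+1)⋯(K+2m−2) = ∏_{i<m−1}((K+m−½)² − (i+½)²)`).
[cite: FreitasMaoSalavessa2025, §2.2 (`m(K) = K^{\overline{n−1}}/(n−1)!`); Kirsten2001, §3.2 eq. (3.2.19) (the substitution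
`ν = l + (d−1)/2`)] -/
theorem evenHemisphere_boundary_multiplicity_eq (m : ℕ) (hm : 1 ≤ m) (l : ℕ) :
    (((l + 2 * m - 2).choose (2 * m - 2) : ℕ) : ℝ) =
      (2 * (m : ℝ) - 1) * (C (1 / (4 ^ (m - 1) * ((2 * m - 1).factorial : ℝ))) *
          ∏ i ∈ Finset.range (m - 1), (X - C ((2 * (i : ℝ) + 1) ^ 2))).eval ((2 * (l : ℝ) + 2 * m - 1) ^ 2) := by
  obtain ⟨M, rfl⟩ : ∃ M, m = M + 1 := ⟨m - 1, by omega⟩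
  have h1 : (((2 * M).factorial : ℕ) : ℝ) * (((l + 2 * M).choose (2 * M) : ℕ) : ℝ) =
      ∏ j ∈ Finset.range (2 * M), ((l : ℝ) + 1 + j) := by
    rw [← Nat.cast_mul, ← Nat.ascFactorial_eq_factorial_mul_choose, Nat.ascFactorial_eq_prod_range]
    push_cast
    exact Finset.prod_congr rfl fun j _ ↦ by ring
  rw [prod_range_two_mul_eq M l] at h1
  rw [show l + 2 * (M + 1) - 2 = l + 2 * M by omega, show 2 * (M + 1) - 2 = 2 * M by omega,
    show 2 * (M + 1) - 1 = 2 * M + 1 by omega, show M + 1 - 1 = M by omega]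
  simp only [eval_mul, eval_C, eval_prod, eval_sub, eval_X]
  have e : ∏ i ∈ Finset.range M, ((2 * (l : ℝ) + 2 * ((M + 1 : ℕ) : ℝ) - 1) ^ 2 - (2 * (i : ℝ) + 1) ^ 2) =
      4 ^ M * ∏ i ∈ Finset.range M, (((l : ℝ) + M + 1 / 2) ^ 2 - ((i : ℝ) + 1 / 2) ^ 2) := by
    rw [show (4 : ℝ) ^ M = ∏ _i ∈ Finset.range M, (4 : ℝ) by simp, ← Finset.prod_mul_distrib]
    refine Finset.prod_congr rfl fun i _ ↦ ?_
    push_cast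
    ring
  rw [e, ← h1, Nat.factorial_succ]
  have hF : (((2 * M).factorial : ℕ) : ℝ) ≠ 0 := by positivity
  have h4 : (4 : ℝ) ^ M ≠ 0 := by positivity
  push_cast
  field_simp
  ring

/-! ### §2 The heat traces: `E_m = Z_N − Z_D = (2m−1)e^{(2m−1)²t/4}∑_{n≥0} p_m((2n+1)²)e^{−(t/4)(2n+1)²}`,
`Z_D = ½(Z_{S^{2m}} − E_m)`, `Z_N = ½(Z_{S^{2m}} + E_m)` -/

/-- **THE BOUNDARY TRACE `E_m(t) = ∑_{K≥0} C(K+2m−2, 2m−2)e^{−tK(K+2m−1)} = (2m−1)e^{(2m−1)²t/4}∑_{n≥0} p_m((2n+1)²)e^{−(t/4)(2n+1)²}`**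
(`K(K+2m−1) = u²/4 − (2m−1)²/4`, `u = 2n+1`, `n = K+m−1`; the terms `n < m−1` vanish). [cite: FreitasMaoSalavessa2025, §1.3
and §2.2; Kirsten2001, §3.2 eqs. (3.2.19)–(3.2.20)] -/
theorem hasSum_evenHemisphere_boundary_multiplicity (m : ℕ) (hm : 1 ≤ m) {t : ℝ} (ht : 0 < t) :
    HasSum (fun l : ℕ ↦ (((l + 2 * m - 2).choose (2 * m - 2) : ℕ) : ℝ) * rexp (-(t * ((l : ℝ) * (l + 2 * m - 1)))))
      ((2 * (m : ℝ) - 1) * rexp ((2 * (m : ℝ) - 1) ^ 2 / 4 * t) *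
        ∑' n : ℕ, (C (1 / (4 ^ (m - 1) * ((2 * m - 1).factorial : ℝ))) *
          ∏ i ∈ Finset.range (m - 1), (X - C ((2 * (i : ℝ) + 1) ^ 2))).eval ((2 * (n : ℝ) + 1) ^ 2) * rexp (-(t / 4 * (2 * (n : ℝ) + 1) ^ 2))) := by
  set p : ℝ[X] := (C (1 / (4 ^ (m - 1) * ((2 * m - 1).factorial : ℝ))) *
          ∏ i ∈ Finset.range (m - 1), (X - C ((2 * (i : ℝ) + 1) ^ 2))) with hp
  set g : ℕ → ℝ := fun n ↦ p.eval ((2 * (n : ℝ) + 1) ^ 2) * rexp (-(t / 4 * (2 * (n : ℝ) + 1) ^ 2)) with hg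
  have hgs : Summable g := (hasSum_nat_eval_sq_two_mul_add_one_mul_exp p (by positivity : (0 : ℝ) < t / 4)).summable
  have h0 : HasSum g (∑' n : ℕ, g n) := hgs.hasSum
  have h1 := (hasSum_nat_add_iff' (m - 1)).mpr h0
  have hz : ∑ n ∈ Finset.range (m - 1), g n = 0 := Finset.sum_eq_zero fun n hn ↦ by
    simp only [hg, hp]
    rw [eval_evenSphere_poly_eq_zero m (by have := Finset.mem_range.mp hn; omega), zero_mul]
  rw [hz, sub_zero] at h1
  have h2 := h1.mul_left ((2 * (m : ℝ) - 1) * rexp ((2 * (m : ℝ) - 1) ^ 2 / 4 * t))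
  refine h2.congr_fun fun l ↦ ?_
  rw [evenHemisphere_boundary_multiplicity_eq m hm l, ← hp]
  simp only [hg]
  have ecast : ((l + (m - 1) : ℕ) : ℝ) = (l : ℝ) + m - 1 := by
    rw [Nat.cast_add, Nat.cast_sub hm]; push_cast; ring
  rw [ecast]
  have e : rexp (-(t * ((l : ℝ) * ((l : ℝ) + 2 * (m : ℝ) - 1)))) =
      rexp ((2 * (m : ℝ) - 1) ^ 2 / 4 * t) * rexp (-(t / 4 * (2 * ((l : ℝ) + m - 1) + 1) ^ 2)) := by
    rw [← Real.exp_add]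
    congr 1
    ring
  rw [e, show 2 * ((l : ℝ) + m - 1) + 1 = 2 * (l : ℝ) + 2 * m - 1 by ring]
  ring

/-- The boundary trace converges. [cite: FreitasMaoSalavessa2025, §2.2] -/
theorem summable_evenHemisphere_boundary_multiplicity (m : ℕ) (hm : 1 ≤ m) {t : ℝ} (ht : 0 < t) :
    Summable fun l : ℕ ↦ (((l + 2 * m - 2).choose (2 * m - 2) : ℕ) : ℝ) * rexp (-(t * ((l : ℝ) * (l + 2 * m - 1)))) :=
  (hasSum_evenHemisphere_boundary_multiplicity m hm ht).summable

/-- **THE DIRICHLET HEMISPHERE `S^{2m}_+`, SUMMED WITH MULTIPLICITIES: `Z_D(t) = ∑_K C(K+2m−2, 2m−1)e^{−tK(K+2m−1)} =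
½(Z_{S^{2m}}(t) − E_m(t))`** ("`λ̄_K = K(K+n−1)`, `K = 1, 2, …`, with multiplicity `m(K) = binom(n+K−2, n−1)`", `n = 2m`; the
term `K = 0` is `C(2m−2, 2m−1) = 0`). [cite: FreitasMaoSalavessa2025, §2.2] -/
theorem hasSum_dirichletEvenHemisphere_multiplicity (m : ℕ) (hm : 1 ≤ m) {t : ℝ} (ht : 0 < t) :
    HasSum (fun l : ℕ ↦ (((l + 2 * m - 2).choose (2 * m - 1) : ℕ) : ℝ) * rexp (-(t * ((l : ℝ) * (l + 2 * m - 1)))))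
      (1 / 2 * ((rexp ((2 * (m : ℝ) - 1) ^ 2 / 4 * t) * ∑' n : ℕ, (∑ k ∈ Finset.range m,
        (C (1 / (4 ^ (m - 1) * ((2 * m - 1).factorial : ℝ))) *
          ∏ i ∈ Finset.range (m - 1), (X - C ((2 * (i : ℝ) + 1) ^ 2))).coeff k * (2 * (n : ℝ) + 1) ^ (2 * k + 1)) *
        rexp (-(t * ((n : ℝ) + 1 / 2) ^ 2))) - ((2 * (m : ℝ) - 1) * rexp ((2 * (m : ℝ) - 1) ^ 2 / 4 * t) *
        ∑' n : ℕ, (C (1 / (4 ^ (m - 1) * ((2 * m - 1).factorial : ℝ))) *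
          ∏ i ∈ Finset.range (m - 1), (X - C ((2 * (i : ℝ) + 1) ^ 2))).eval ((2 * (n : ℝ) + 1) ^ 2) * rexp (-(t / 4 * (2 * (n : ℝ) + 1) ^ 2))))) := by
  have h := ((hasSum_evenSphere_multiplicity m hm ht).sub (hasSum_evenHemisphere_boundary_multiplicity m hm ht)).mul_left
    (1 / 2 : ℝ)
  refine h.congr_fun fun l ↦ ?_
  rw [evenHemisphere_multiplicity_neumann_eq_add m hm l]
  push_cast
  ring

/-- **THE NEUMANN HEMISPHERE: `Z_N(t) = ∑_K C(K+2m−1, 2m−1)e^{−tK(K+2m−1)} = ½(Z_{S^{2m}}(t) + E_m(t))`** (multiplicity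
`m_{S^{2m}}(K) − binom(2m+K−2, 2m−1)`: "the spectrum of `Sⁿ` consists of the union of the Dirichlet and Neumann spectra on
`Sⁿ₊`"). [cite: FreitasMaoSalavessa2025, §1.3 and §2.1–§2.2] -/
theorem hasSum_neumannEvenHemisphere_multiplicity (m : ℕ) (hm : 1 ≤ m) {t : ℝ} (ht : 0 < t) :
    HasSum (fun l : ℕ ↦ (((l + 2 * m - 1).choose (2 * m - 1) : ℕ) : ℝ) * rexp (-(t * ((l : ℝ) * (l + 2 * m - 1)))))
      (1 / 2 * ((rexp ((2 * (m : ℝ) - 1) ^ 2 / 4 * t) * ∑' n : ℕ, (∑ k ∈ Finset.range m,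
        (C (1 / (4 ^ (m - 1) * ((2 * m - 1).factorial : ℝ))) *
          ∏ i ∈ Finset.range (m - 1), (X - C ((2 * (i : ℝ) + 1) ^ 2))).coeff k * (2 * (n : ℝ) + 1) ^ (2 * k + 1)) *
        rexp (-(t * ((n : ℝ) + 1 / 2) ^ 2))) + ((2 * (m : ℝ) - 1) * rexp ((2 * (m : ℝ) - 1) ^ 2 / 4 * t) *
        ∑' n : ℕ, (C (1 / (4 ^ (m - 1) * ((2 * m - 1).factorial : ℝ))) *
          ∏ i ∈ Finset.range (m - 1), (X - C ((2 * (i : ℝ) + 1) ^ 2))).eval ((2 * (n : ℝ) + 1) ^ 2) * rexp (-(t / 4 * (2 * (n : ℝ) + 1) ^ 2))))) := by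
  have h := ((hasSum_evenSphere_multiplicity m hm ht).add (hasSum_evenHemisphere_boundary_multiplicity m hm ht)).mul_left
    (1 / 2 : ℝ)
  refine h.congr_fun fun l ↦ ?_
  rw [evenHemisphere_multiplicity_neumann_eq_add m hm l]
  push_cast
  ring

/-- **The Dirichlet hemisphere as a family** on `Σ K, Fin C(K+2m−2, 2m−1)` (the eigenvalue `K(K+2m−1)` repeated according
to its multiplicity): `∑ e^{−tK(K+2m−1)} = ½(Z_{S^{2m}} − E_m)`. [cite: FreitasMaoSalavessa2025, §2.2; Berard1986, Ch. VII
nº1 (ii) (`Z(t) = ∑ exp(−λⱼt)`)] -/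
theorem hasSum_dirichletEvenHemisphere (m : ℕ) (hm : 1 ≤ m) {t : ℝ} (ht : 0 < t) :
    HasSum (fun i : (Σ l : ℕ, Fin ((l + 2 * m - 2).choose (2 * m - 1))) ↦ rexp (-(t * ((i.1 : ℝ) * (i.1 + 2 * m - 1))))) (1 / 2 * ((rexp ((2 * (m : ℝ) - 1) ^ 2 / 4 * t) * ∑' n : ℕ, (∑ k ∈ Finset.range m,
        (C (1 / (4 ^ (m - 1) * ((2 * m - 1).factorial : ℝ))) *
          ∏ i ∈ Finset.range (m - 1), (X - C ((2 * (i : ℝ) + 1) ^ 2))).coeff k * (2 * (n : ℝ) + 1) ^ (2 * k + 1)) *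
        rexp (-(t * ((n : ℝ) + 1 / 2) ^ 2))) - ((2 * (m : ℝ) - 1) * rexp ((2 * (m : ℝ) - 1) ^ 2 / 4 * t) *
        ∑' n : ℕ, (C (1 / (4 ^ (m - 1) * ((2 * m - 1).factorial : ℝ))) *
          ∏ i ∈ Finset.range (m - 1), (X - C ((2 * (i : ℝ) + 1) ^ 2))).eval ((2 * (n : ℝ) + 1) ^ 2) * rexp (-(t / 4 * (2 * (n : ℝ) + 1) ^ 2))))) :=
  hasSum_sigma_fin_of_hasSum_natCast_mul (d := fun l ↦ (l + 2 * m - 2).choose (2 * m - 1))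
    (fun _ ↦ (Real.exp_pos _).le) (hasSum_dirichletEvenHemisphere_multiplicity m hm ht)

/-- The Dirichlet heat trace of `S^{2m}_+` converges for `t > 0`. [cite: FreitasMaoSalavessa2025, §2.2] -/
theorem summable_dirichletEvenHemisphere (m : ℕ) (hm : 1 ≤ m) {t : ℝ} (ht : 0 < t) :
    Summable fun i : (Σ l : ℕ, Fin ((l + 2 * m - 2).choose (2 * m - 1))) ↦ rexp (-(t * ((i.1 : ℝ) * (i.1 + 2 * m - 1)))) :=
  (hasSum_dirichletEvenHemisphere m hm ht).summable

/-- **The Neumann hemisphere as a family** on `Σ K, Fin C(K+2m−1, 2m−1)`: `∑ e^{−tK(K+2m−1)} = ½(Z_{S^{2m}} + E_m)`.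
[cite: FreitasMaoSalavessa2025, §1.3; Berard1986, Ch. VII nº1 (ii)] -/
theorem hasSum_neumannEvenHemisphere (m : ℕ) (hm : 1 ≤ m) {t : ℝ} (ht : 0 < t) :
    HasSum (fun i : (Σ l : ℕ, Fin ((l + 2 * m - 1).choose (2 * m - 1))) ↦ rexp (-(t * ((i.1 : ℝ) * (i.1 + 2 * m - 1))))) (1 / 2 * ((rexp ((2 * (m : ℝ) - 1) ^ 2 / 4 * t) * ∑' n : ℕ, (∑ k ∈ Finset.range m,
        (C (1 / (4 ^ (m - 1) * ((2 * m - 1).factorial : ℝ))) *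
          ∏ i ∈ Finset.range (m - 1), (X - C ((2 * (i : ℝ) + 1) ^ 2))).coeff k * (2 * (n : ℝ) + 1) ^ (2 * k + 1)) *
        rexp (-(t * ((n : ℝ) + 1 / 2) ^ 2))) + ((2 * (m : ℝ) - 1) * rexp ((2 * (m : ℝ) - 1) ^ 2 / 4 * t) *
        ∑' n : ℕ, (C (1 / (4 ^ (m - 1) * ((2 * m - 1).factorial : ℝ))) *
          ∏ i ∈ Finset.range (m - 1), (X - C ((2 * (i : ℝ) + 1) ^ 2))).eval ((2 * (n : ℝ) + 1) ^ 2) * rexp (-(t / 4 * (2 * (n : ℝ) + 1) ^ 2))))) :=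
  hasSum_sigma_fin_of_hasSum_natCast_mul (d := fun l ↦ (l + 2 * m - 1).choose (2 * m - 1))
    (fun _ ↦ (Real.exp_pos _).le) (hasSum_neumannEvenHemisphere_multiplicity m hm ht)

/-- The Neumann heat trace of `S^{2m}_+` converges for `t > 0`. [cite: FreitasMaoSalavessa2025, §1.3] -/
theorem summable_neumannEvenHemisphere (m : ℕ) (hm : 1 ≤ m) {t : ℝ} (ht : 0 < t) :
    Summable fun i : (Σ l : ℕ, Fin ((l + 2 * m - 1).choose (2 * m - 1))) ↦ rexp (-(t * ((i.1 : ℝ) * (i.1 + 2 * m - 1)))) :=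
  (hasSum_neumannEvenHemisphere m hm ht).summable

/-- **`Z_D(t) + Z_N(t) = Z_{S^{2m}}(t)`** — the two hemisphere problems together make up the spectrum of the sphere.
[cite: FreitasMaoSalavessa2025, §1.3] -/
theorem tsum_dirichletEvenHemisphere_add_tsum_neumannEvenHemisphere (m : ℕ) (hm : 1 ≤ m) {t : ℝ} (ht : 0 < t) :
    ∑' i : (Σ l : ℕ, Fin ((l + 2 * m - 2).choose (2 * m - 1))), rexp (-(t * ((i.1 : ℝ) * (i.1 + 2 * m - 1)))) + ∑' i : (Σ l : ℕ, Fin ((l + 2 * m - 1).choose (2 * m - 1))), rexp (-(t * ((i.1 : ℝ) * (i.1 + 2 * m - 1)))) =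
      ∑' i : (Σ l : ℕ, Fin ((l + 2 * m - 1).choose (2 * m - 1) + (l + 2 * m - 2).choose (2 * m - 1))), rexp (-(t * ((i.1 : ℝ) * (i.1 + 2 * m - 1)))) := by
  rw [(hasSum_dirichletEvenHemisphere m hm ht).tsum_eq, (hasSum_neumannEvenHemisphere m hm ht).tsum_eq, tsum_evenSphere m hm ht]
  ring

/-- **`Z_N(t) − Z_D(t) = E_m(t) = ∑_K C(K+2m−2, 2m−2)e^{−tK(K+2m−1)}`**. [cite: FreitasMaoSalavessa2025, §1.3 and §2.2] -/
theorem tsum_neumannEvenHemisphere_sub_tsum_dirichletEvenHemisphere (m : ℕ) (hm : 1 ≤ m) {t : ℝ} (ht : 0 < t) :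
    ∑' i : (Σ l : ℕ, Fin ((l + 2 * m - 1).choose (2 * m - 1))), rexp (-(t * ((i.1 : ℝ) * (i.1 + 2 * m - 1)))) - ∑' i : (Σ l : ℕ, Fin ((l + 2 * m - 2).choose (2 * m - 1))), rexp (-(t * ((i.1 : ℝ) * (i.1 + 2 * m - 1)))) =
      ∑' l : ℕ, (((l + 2 * m - 2).choose (2 * m - 2) : ℕ) : ℝ) * rexp (-(t * ((l : ℝ) * (l + 2 * m - 1)))) := by
  rw [(hasSum_dirichletEvenHemisphere m hm ht).tsum_eq, (hasSum_neumannEvenHemisphere m hm ht).tsum_eq,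
    (hasSum_evenHemisphere_boundary_multiplicity m hm ht).tsum_eq]
  ring

/-- The Dirichlet eigenvalues with multiplicity tend to `∞` (discrete spectrum). [cite: Berard1986, Ch. VII nº1 (i);
FreitasMaoSalavessa2025, §2.2] -/
theorem tendsto_dirichletEvenHemisphere_cofinite_atTop (m : ℕ) (hm : 1 ≤ m) :
    Tendsto (fun i : (Σ l : ℕ, Fin ((l + 2 * m - 2).choose (2 * m - 1))) ↦ ((i.1 : ℝ) * (i.1 + 2 * m - 1))) cofinite atTop :=
  tendsto_sigma_fin_cofinite_atTop (tendsto_natCast_mul_add_sub_one_atTop m hm)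

/-- The Neumann eigenvalues with multiplicity tend to `∞`. [cite: Berard1986, Ch. VII nº1 (i); FreitasMaoSalavessa2025, §1.3] -/
theorem tendsto_neumannEvenHemisphere_cofinite_atTop (m : ℕ) (hm : 1 ≤ m) :
    Tendsto (fun i : (Σ l : ℕ, Fin ((l + 2 * m - 1).choose (2 * m - 1))) ↦ ((i.1 : ℝ) * (i.1 + 2 * m - 1))) cofinite atTop :=
  tendsto_sigma_fin_cofinite_atTop (tendsto_natCast_mul_add_sub_one_atTop m hm)

/-- `K(K+2m−1) = 0 ↔ K = 0` (`m ≥ 1`). [folklore] -/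
private theorem natCast_mul_add_sub_one_eq_zero_iff (m : ℕ) (hm : 1 ≤ m) (l : ℕ) :
    (l : ℝ) * (l + 2 * m - 1) = 0 ↔ l = 0 := by
  have hm1 : (1 : ℝ) ≤ m := by exact_mod_cast hm
  constructor
  · intro h
    rcases mul_eq_zero.mp h with h | h
    · exact_mod_cast h
    · have : (0 : ℝ) < (l : ℝ) + 2 * m - 1 := by linarith [(l.cast_nonneg : (0 : ℝ) ≤ l)]
      linarith
  · rintro rfl; simp

/-- **The Dirichlet hemisphere has NO zero mode** (`D(0) = C(2m−2, 2m−1) = 0`: "`K = 1, 2, …`"). [cite: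
FreitasMaoSalavessa2025, §2.2] -/
theorem ncard_setOf_dirichletEvenHemisphere_eq_zero (m : ℕ) (hm : 1 ≤ m) :
    {i : (Σ l : ℕ, Fin ((l + 2 * m - 2).choose (2 * m - 1))) | ((i.1 : ℝ) * (i.1 + 2 * m - 1)) = 0}.ncard = 0 := by
  rw [ncard_setOf_sigma_fin_eq (d := fun l ↦ (l + 2 * m - 2).choose (2 * m - 1))
    (μ := fun l : ℕ ↦ (l : ℝ) * (l + 2 * m - 1)) (natCast_mul_add_sub_one_eq_zero_iff m hm)]
  simp only [zero_add, Nat.choose_eq_zero_of_lt (show 2 * m - 2 < 2 * m - 1 by omega)]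

/-- **The Neumann hemisphere has exactly ONE zero mode** (the constants: `N(0) = C(2m−1, 2m−1) = 1`). [cite:
FreitasMaoSalavessa2025, §1.3] -/
theorem ncard_setOf_neumannEvenHemisphere_eq_zero (m : ℕ) (hm : 1 ≤ m) :
    {i : (Σ l : ℕ, Fin ((l + 2 * m - 1).choose (2 * m - 1))) | ((i.1 : ℝ) * (i.1 + 2 * m - 1)) = 0}.ncard = 1 := by
  rw [ncard_setOf_sigma_fin_eq (d := fun l ↦ (l + 2 * m - 1).choose (2 * m - 1))
    (μ := fun l : ℕ ↦ (l : ℝ) * (l + 2 * m - 1)) (natCast_mul_add_sub_one_eq_zero_iff m hm)]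
  simp only [zero_add, Nat.choose_self]

/-! ### §3 The expansions: half-integer powers from the boundary trace, integer powers from the sphere -/

/-- `t ↦ t/4` preserves `𝓝[>] 0`. [folklore] -/
private theorem tendsto_div_four_nhdsGT : Tendsto (fun t : ℝ ↦ t / 4) (𝓝[>] 0) (𝓝[>] 0) := by
  refine tendsto_nhdsWithin_of_tendsto_nhds_of_eventually_within _ ?_ ?_
  · have h := (tendsto_id (α := ℝ) (x := 𝓝 0)).div_const 4
    rw [zero_div] at h
    exact h.mono_left nhdsWithin_le_nhds
  · filter_upwards [self_mem_nhdsWithin] with t (ht : 0 < t)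
    exact div_pos ht four_pos

/-- **THE BOUNDARY THETA SUM TO ALL ORDERS: `∑_{n≥0} p_m((2n+1)²)e^{−(t/4)(2n+1)²} − ∑_{i<m} p_{m,i}·½·4ⁱΓ(i+½)·t^{−(i+½)} =
O(t^β)` for EVERY `β`** — the even-weight tool of row g39-#3 (`∑_{j≥0} p((2j+1)²)e^{−s(2j+1)²} = ¼∑ᵢ pᵢΓ(i+½)s^{−(i+½)} +
O(s^β)`) read at `s = t/4` (`¼Γ(i+½)(t/4)^{−(i+½)} = ½4ⁱΓ(i+½)t^{−(i+½)}`): pure half-integer powers, no constant term.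
[cite: Berard1986, Ch. V nº6 (ii) (theta series of the odd integers); Kirsten2001, §3.2 eq. (3.2.19)] -/
theorem isBigO_evenSphereBoundaryTheta_sub (m : ℕ) (hm : 1 ≤ m) (β : ℝ) :
    (fun t : ℝ ↦ ∑' n : ℕ, (C (1 / (4 ^ (m - 1) * ((2 * m - 1).factorial : ℝ))) *
          ∏ i ∈ Finset.range (m - 1), (X - C ((2 * (i : ℝ) + 1) ^ 2))).eval ((2 * (n : ℝ) + 1) ^ 2) * rexp (-(t / 4 * (2 * (n : ℝ) + 1) ^ 2)) -
      ∑ i ∈ Finset.range m, (C (1 / (4 ^ (m - 1) * ((2 * m - 1).factorial : ℝ))) *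
          ∏ i ∈ Finset.range (m - 1), (X - C ((2 * (i : ℝ) + 1) ^ 2))).coeff i * (4 ^ i * Real.Gamma ((i : ℝ) + 1 / 2) / 2) * t ^ (-((i : ℝ) + 1 / 2)))
      =O[𝓝[>] 0] fun t : ℝ ↦ t ^ β := by
  set p : ℝ[X] := (C (1 / (4 ^ (m - 1) * ((2 * m - 1).factorial : ℝ))) *
          ∏ i ∈ Finset.range (m - 1), (X - C ((2 * (i : ℝ) + 1) ^ 2))) with hp
  have h := (isBigO_tsum_nat_eval_sq_two_mul_add_one_sub p β).comp_tendsto tendsto_div_four_nhdsGT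
  rw [hp, natDegree_evenSphere_poly m, Nat.sub_add_cancel hm, ← hp] at h
  have h4β : (fun t : ℝ ↦ (t / 4) ^ β) =O[𝓝[>] 0] fun t : ℝ ↦ t ^ β := by
    refine IsBigO.of_bound (((4 : ℝ) ^ β)⁻¹) ?_
    filter_upwards [self_mem_nhdsWithin] with t (ht : 0 < t)
    rw [Real.div_rpow ht.le (by norm_num : (0 : ℝ) ≤ 4), Real.norm_of_nonneg (by positivity),
      Real.norm_of_nonneg (by positivity), div_eq_inv_mul]
  have h412 : (4 : ℝ) ^ (1 / 2 : ℝ) = 2 := by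
    rw [show (4 : ℝ) = 2 ^ (2 : ℝ) by norm_num, ← Real.rpow_mul (by norm_num)]; norm_num
  refine (h.trans h4β).congr' ?_ EventuallyEq.rfl
  filter_upwards [self_mem_nhdsWithin] with t (ht : 0 < t)
  simp only [Function.comp_apply]
  rw [Finset.mul_sum]
  congr 1
  refine Finset.sum_congr rfl fun i _ ↦ ?_
  have e1 : (t / 4) ^ (-((i : ℝ) + 1 / 2)) = t ^ (-((i : ℝ) + 1 / 2)) * (2 * 4 ^ i) := by
    rw [Real.div_rpow ht.le (by norm_num : (0 : ℝ) ≤ 4), Real.rpow_neg (by norm_num : (0 : ℝ) ≤ 4),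
      Real.rpow_add (by norm_num : (0 : ℝ) < 4), Real.rpow_natCast, h412, div_eq_mul_inv, inv_inv]
    ring
  rw [e1]
  ring

/-- A real polynomial minus its truncation below degree `N+1` is `O(t^{N+1})` at `0`. [folklore] -/
private theorem isBigO_eval_sub_sum_coeff (q : ℝ[X]) (N : ℕ) :
    (fun t : ℝ ↦ q.eval t - ∑ k ∈ Finset.range (N + 1), q.coeff k * t ^ k) =O[𝓝[>] 0]
      fun t : ℝ ↦ t ^ (N + 1) := by
  set Dp : ℝ[X] := q - ∑ k ∈ Finset.range (N + 1), C (q.coeff k) * X ^ k with hDp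
  have hcoeff : ∀ d < N + 1, Dp.coeff d = 0 := by
    intro d hd
    simp only [hDp, coeff_sub, finsetSum_coeff, coeff_C_mul_X_pow]
    rw [Finset.sum_ite_eq, if_pos (Finset.mem_range.mpr hd), sub_self]
  obtain ⟨r, hr⟩ := Polynomial.X_pow_dvd_iff.mpr hcoeff
  have hev : ∀ t : ℝ, q.eval t - ∑ k ∈ Finset.range (N + 1), q.coeff k * t ^ k = t ^ (N + 1) * r.eval t := by
    intro t
    have := congrArg (Polynomial.eval t) hr
    simp only [hDp, eval_sub, eval_finsetSum, eval_mul, eval_C, eval_pow, eval_X] at this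
    rw [this]
  have hr1 : (fun t : ℝ ↦ r.eval t) =O[𝓝[>] 0] fun _ : ℝ ↦ (1 : ℝ) :=
    ((r.continuous.tendsto 0).isBigO_one ℝ).mono nhdsWithin_le_nhds
  have h := (isBigO_refl (fun t : ℝ ↦ t ^ (N + 1)) (𝓝[>] (0 : ℝ))).mul hr1
  simp only [mul_one] at h
  exact h.congr' (Eventually.of_forall fun t ↦ (hev t).symm) EventuallyEq.rfl

/-- `e^{ct} − ∑_{i≤M} cⁱtⁱ/i! = O(t^{M+1})` at `0⁺`, for every real `c`. [folklore] -/
private theorem isBigO_exp_const_mul_sub_sum (c : ℝ) (M : ℕ) :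
    (fun t : ℝ ↦ rexp (c * t) - ∑ i ∈ Finset.range (M + 1), c ^ i / (i.factorial : ℝ) * t ^ i) =O[𝓝[>] 0]
      fun t : ℝ ↦ t ^ (M + 1) := by
  refine IsBigO.of_bound (|c| ^ (M + 1) * (((M + 2 : ℕ) : ℝ) / (((M + 1).factorial : ℝ) * ((M + 1 : ℕ) : ℝ)))) ?_
  have hδ : (0 : ℝ) < 1 / (|c| + 1) := by positivity
  filter_upwards [Ioc_mem_nhdsGT hδ] with t ht
  have ht0 : 0 < t := ht.1
  have hct : |c * t| ≤ 1 := by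
    rw [abs_mul, abs_of_pos ht0]
    have h1 : |c| * t ≤ |c| * (1 / (|c| + 1)) := mul_le_mul_of_nonneg_left ht.2 (abs_nonneg c)
    have h2 : |c| * (1 / (|c| + 1)) ≤ 1 := by
      rw [mul_one_div, div_le_one (by positivity)]; linarith [abs_nonneg c]
    exact h1.trans h2
  have hb := Real.exp_bound hct (Nat.succ_pos M)
  simp only [Nat.succ_eq_add_one] at hb
  have e : ∑ i ∈ Finset.range (M + 1), c ^ i / (i.factorial : ℝ) * t ^ i = ∑ i ∈ Finset.range (M + 1), (c * t) ^ i / (i.factorial : ℝ) :=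
    Finset.sum_congr rfl fun i _ ↦ by rw [mul_pow]; ring
  rw [Real.norm_eq_abs, Real.norm_of_nonneg (pow_nonneg ht0.le _), e]
  refine hb.trans (le_of_eq ?_)
  rw [abs_mul, abs_of_pos ht0, mul_pow]
  push_cast
  ring

/-- **Cauchy product with an exponential.** If `Φ(t) − ∑_{j≤N+1} q_j tʲ = O(t^{N+2})` at `0⁺`, then
`e^{ct}Φ(t) − ∑_{k≤N} (∑_{a+b=k} (cᵃ/a!)q_b) tᵏ = O(t^{N+1})`. [folklore] -/
private theorem isBigO_exp_mul_sub_sum_antidiagonal (c : ℝ) (q : ℕ → ℝ) (Φ : ℝ → ℝ) (N : ℕ)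
    (hΦ : (fun t : ℝ ↦ Φ t - ∑ j ∈ Finset.range (N + 1 + 1), q j * t ^ j) =O[𝓝[>] 0] fun t : ℝ ↦ t ^ (N + 1 + 1)) :
    (fun t : ℝ ↦ rexp (c * t) * Φ t -
      ∑ k ∈ Finset.range (N + 1), (∑ x ∈ Finset.HasAntidiagonal.antidiagonal k, c ^ x.1 / (x.1.factorial : ℝ) * q x.2) * t ^ k)
      =O[𝓝[>] 0] fun t : ℝ ↦ t ^ (N + 1) := by
  set cc : ℕ → ℝ := fun i ↦ c ^ i / (i.factorial : ℝ) with hcc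
  set d : ℕ → ℝ := fun k ↦ ∑ x ∈ Finset.HasAntidiagonal.antidiagonal k, cc x.1 * q x.2 with hd
  set P : ℝ[X] := ∑ i ∈ Finset.range (N + 1 + 1), C (cc i) * X ^ i with hP
  set Q : ℝ[X] := ∑ j ∈ Finset.range (N + 1 + 1), C (q j) * X ^ j with hQ
  have hPev : ∀ t : ℝ, P.eval t = ∑ i ∈ Finset.range (N + 1 + 1), cc i * t ^ i := fun t ↦ by
    simp only [hP, eval_finsetSum, eval_mul, eval_C, eval_pow, eval_X]
  have hQev : ∀ t : ℝ, Q.eval t = ∑ j ∈ Finset.range (N + 1 + 1), q j * t ^ j := fun t ↦ by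
    simp only [hQ, eval_finsetSum, eval_mul, eval_C, eval_pow, eval_X]
  have hPc : ∀ i, P.coeff i = if i ∈ Finset.range (N + 1 + 1) then cc i else 0 := fun i ↦ by
    simp only [hP, finsetSum_coeff, coeff_C_mul_X_pow]
    rw [Finset.sum_ite_eq]
  have hQc : ∀ j, Q.coeff j = if j ∈ Finset.range (N + 1 + 1) then q j else 0 := fun j ↦ by
    simp only [hQ, finsetSum_coeff, coeff_C_mul_X_pow]
    rw [Finset.sum_ite_eq]
  have hPQc : ∀ k < N + 1, (P * Q).coeff k = d k := by
    intro k hk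
    rw [coeff_mul, hd]
    refine Finset.sum_congr rfl fun x hx ↦ ?_
    rw [Finset.HasAntidiagonal.mem_antidiagonal] at hx
    rw [hPc, hQc, if_pos (Finset.mem_range.mpr (by omega)), if_pos (Finset.mem_range.mpr (by omega))]
  have h1 : (fun t : ℝ ↦ rexp (c * t) - P.eval t) =O[𝓝[>] 0] fun t : ℝ ↦ t ^ (N + 1 + 1) :=
    (isBigO_exp_const_mul_sub_sum c (N + 1)).congr' (Eventually.of_forall fun t ↦ by simp only [hPev, hcc]) EventuallyEq.rfl
  have h2 : (fun t : ℝ ↦ Φ t - Q.eval t) =O[𝓝[>] 0] fun t : ℝ ↦ t ^ (N + 1 + 1) :=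
    hΦ.congr' (Eventually.of_forall fun t ↦ by simp only [hQev]) EventuallyEq.rfl
  have hE : (fun t : ℝ ↦ rexp (c * t)) =O[𝓝[>] 0] fun _ : ℝ ↦ (1 : ℝ) :=
    (((by fun_prop : Continuous fun t : ℝ ↦ rexp (c * t)).tendsto 0).isBigO_one ℝ).mono nhdsWithin_le_nhds
  have hQ1 : (fun t : ℝ ↦ Q.eval t) =O[𝓝[>] 0] fun _ : ℝ ↦ (1 : ℝ) :=
    ((Q.continuous.tendsto 0).isBigO_one ℝ).mono nhdsWithin_le_nhds
  have h3 : (fun t : ℝ ↦ rexp (c * t) * Φ t - (P * Q).eval t) =O[𝓝[>] 0] fun t : ℝ ↦ t ^ (N + 1 + 1) := by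
    have h := (hE.mul h2).add (hQ1.mul h1)
    simp only [one_mul] at h
    refine h.congr' ?_ EventuallyEq.rfl
    filter_upwards with t
    rw [eval_mul]
    ring
  have h4 : (fun t : ℝ ↦ (P * Q).eval t - ∑ k ∈ Finset.range (N + 1), d k * t ^ k) =O[𝓝[>] 0]
      fun t : ℝ ↦ t ^ (N + 1) :=
    (isBigO_eval_sub_sum_coeff (P * Q) N).congr' (Eventually.of_forall fun t ↦ by
      simp only
      exact congrArg (fun x : ℝ ↦ (P * Q).eval t - x)
        (Finset.sum_congr rfl fun k hk ↦ by rw [hPQc k (Finset.mem_range.mp hk)])) EventuallyEq.rfl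
  have h34 : (fun t : ℝ ↦ t ^ (N + 1 + 1)) =O[𝓝[>] 0] fun t : ℝ ↦ t ^ (N + 1) := by
    refine IsBigO.of_bound 1 ?_
    filter_upwards [Ioc_mem_nhdsGT (zero_lt_one' ℝ)] with t ht
    rw [Real.norm_of_nonneg (pow_nonneg ht.1.le _), Real.norm_of_nonneg (pow_nonneg ht.1.le _), one_mul, pow_succ]
    exact mul_le_of_le_one_right (pow_nonneg ht.1.le _) ht.2
  have h := (h3.trans h34).add h4
  refine h.congr' ?_ EventuallyEq.rfl
  filter_upwards with t
  simp only [hd, hcc]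
  ring

/-- **THE BOUNDARY TRACE TO ALL ORDERS — HALF-INTEGER POWERS ONLY: `E_m(t) − ∑_{n≤m+N} B_{m,n}t^{n−m+½} = O(t^{N+3/2})`,
`B_{m,n} = (2m−1)∑_{a+b=n, b<m}(cᵃ/a!)·p_{m,m−1−b}·½4^{m−1−b}Γ(m−b−½)`**, `c = (2m−1)²/4` — the Cauchy product of
`e^{(2m−1)²t/4}` with the finitely many singular terms of `isBigO_evenSphereBoundaryTheta_sub`; these are McKean–Singer's
`±¼√(4πt)·area(∂)/(4πt)^m` and ALL its successors for the hemisphere (the boundary is totally geodesic, every second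
invariant comes from the boundary alone). [cite: McKeanSinger1967, eq. (6) p. 45; FreitasMaoSalavessa2025, §2.2; Berard1986,
Ch. V nº6 (ii)] -/
theorem isBigO_evenHemisphere_boundary_expansion (m : ℕ) (hm : 1 ≤ m) (N : ℕ) :
    (fun t : ℝ ↦ ∑' l : ℕ, (((l + 2 * m - 2).choose (2 * m - 2) : ℕ) : ℝ) * rexp (-(t * ((l : ℝ) * (l + 2 * m - 1)))) -
      ∑ n : Fin (m + N + 1), (fun n : Fin (m + N + 1) ↦ ((2 * (m : ℝ) - 1) * ∑ x ∈ Finset.HasAntidiagonal.antidiagonal (n : ℕ), ((2 * (m : ℝ) - 1) ^ 2 / 4) ^ x.1 / (x.1.factorial : ℝ) *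
        (if x.2 < m then (C (1 / (4 ^ (m - 1) * ((2 * m - 1).factorial : ℝ))) *
          ∏ i ∈ Finset.range (m - 1), (X - C ((2 * (i : ℝ) + 1) ^ 2))).coeff (m - 1 - x.2) * (4 ^ (m - 1 - x.2) * Real.Gamma (((m - 1 - x.2 : ℕ) : ℝ) + 1 / 2) / 2) else 0))) n * t ^ ((fun n : Fin (m + N + 1) ↦ ((n : ℕ) : ℝ) - m + 1 / 2) n))
      =O[𝓝[>] 0] fun t : ℝ ↦ t ^ ((N : ℝ) + 3 / 2) := by
  set p : ℝ[X] := (C (1 / (4 ^ (m - 1) * ((2 * m - 1).factorial : ℝ))) *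
          ∏ i ∈ Finset.range (m - 1), (X - C ((2 * (i : ℝ) + 1) ^ 2))) with hp
  set c : ℝ := (2 * (m : ℝ) - 1) ^ 2 / 4 with hc
  set V : ℝ → ℝ := fun t ↦ ∑' n : ℕ, p.eval ((2 * (n : ℝ) + 1) ^ 2) * rexp (-(t / 4 * (2 * (n : ℝ) + 1) ^ 2)) with hV
  set q : ℕ → ℝ := fun b ↦ if b < m then p.coeff (m - 1 - b) *
    (4 ^ (m - 1 - b) * Real.Gamma (((m - 1 - b : ℕ) : ℝ) + 1 / 2) / 2) else 0 with hq
  -- Step 1: `t^{m−½}V(t)` is a polynomial up to `O(t^∞)`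
  have hV' := isBigO_evenSphereBoundaryTheta_sub m hm ((N : ℝ) + 5 / 2)
  rw [← hp] at hV'
  have hΦ : (fun t : ℝ ↦ t ^ ((m : ℝ) - 1 / 2) * V t - ∑ j ∈ Finset.range (m + N + 1 + 1), q j * t ^ j) =O[𝓝[>] 0]
      fun t : ℝ ↦ t ^ (m + N + 1 + 1) := by
    have h := (isBigO_refl (fun t : ℝ ↦ t ^ ((m : ℝ) - 1 / 2)) (𝓝[>] (0 : ℝ))).mul hV'
    have h' : (fun t : ℝ ↦ t ^ ((m : ℝ) - 1 / 2) * t ^ ((N : ℝ) + 5 / 2)) =O[𝓝[>] 0] fun t : ℝ ↦ t ^ (m + N + 1 + 1) := by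
      refine IsBigO.of_bound 1 ?_
      filter_upwards [self_mem_nhdsWithin] with t (ht : 0 < t)
      rw [← Real.rpow_add ht, show (m : ℝ) - 1 / 2 + ((N : ℝ) + 5 / 2) = ((m + N + 1 + 1 : ℕ) : ℝ) by push_cast; ring,
        Real.rpow_natCast, one_mul]
    refine (h.trans h').congr' ?_ EventuallyEq.rfl
    filter_upwards [self_mem_nhdsWithin] with t (ht : 0 < t)
    rw [mul_sub, Finset.mul_sum, show m + N + 1 + 1 = m + (N + 2) by ring, Finset.sum_range_add]
    have hz : ∑ x ∈ Finset.range (N + 2), q (m + x) * t ^ (m + x) = 0 := Finset.sum_eq_zero fun x _ ↦ by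
      simp only [hq, if_neg (show ¬ (m + x < m) by omega), zero_mul]
    rw [hz, add_zero, ← Finset.sum_range_reflect (fun j ↦ q j * t ^ j) m]
    congr 1
    refine Finset.sum_congr rfl fun j hj ↦ ?_
    have hjm := Finset.mem_range.mp hj
    have hsub : m - 1 - (m - 1 - j) = j := by omega
    simp only [hq, if_pos (show m - 1 - j < m by omega), hsub]
    have ecast : ((m - 1 - j : ℕ) : ℝ) = (m : ℝ) - 1 - j := by
      rw [Nat.cast_sub (by omega : j ≤ m - 1), Nat.cast_sub hm]; push_cast; ring
    rw [← Real.rpow_natCast t (m - 1 - j), ecast,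
      show (m : ℝ) - 1 - j = ((m : ℝ) - 1 / 2) + (-((j : ℝ) + 1 / 2)) by ring, Real.rpow_add ht]
    ring
  -- Step 2: Cauchy product with `e^{ct}`
  have hC := isBigO_exp_mul_sub_sum_antidiagonal c q (fun t ↦ t ^ ((m : ℝ) - 1 / 2) * V t) (m + N) hΦ
  -- Step 3: multiply by `(2m−1)t^{½−m}`
  have h3 := (isBigO_refl (fun t : ℝ ↦ (2 * (m : ℝ) - 1) * t ^ (1 / 2 - (m : ℝ))) (𝓝[>] (0 : ℝ))).mul hC
  have h4 : (fun t : ℝ ↦ (2 * (m : ℝ) - 1) * t ^ (1 / 2 - (m : ℝ)) * t ^ (m + N + 1)) =O[𝓝[>] 0]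
      fun t : ℝ ↦ t ^ ((N : ℝ) + 3 / 2) := by
    have h5 : (fun t : ℝ ↦ t ^ (1 / 2 - (m : ℝ)) * t ^ (m + N + 1)) =ᶠ[𝓝[>] 0] fun t : ℝ ↦ t ^ ((N : ℝ) + 3 / 2) := by
      filter_upwards [self_mem_nhdsWithin] with t (ht : 0 < t)
      rw [← Real.rpow_natCast t (m + N + 1), ← Real.rpow_add ht]
      congr 1
      push_cast
      ring
    refine (h5.isBigO.const_mul_left (2 * (m : ℝ) - 1)).congr' ?_ EventuallyEq.rfl
    filter_upwards with t
    ring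
  refine (h3.trans h4).congr' ?_ EventuallyEq.rfl
  filter_upwards [self_mem_nhdsWithin] with t (ht : 0 < t)
  rw [(hasSum_evenHemisphere_boundary_multiplicity m hm ht).tsum_eq, ← hp, Fin.sum_univ_eq_sum_range
    (fun n : ℕ ↦ ((2 * (m : ℝ) - 1) * ∑ x ∈ Finset.HasAntidiagonal.antidiagonal n, ((2 * (m : ℝ) - 1) ^ 2 / 4) ^ x.1 / (x.1.factorial : ℝ) *
        (if x.2 < m then (C (1 / (4 ^ (m - 1) * ((2 * m - 1).factorial : ℝ))) *
          ∏ i ∈ Finset.range (m - 1), (X - C ((2 * (i : ℝ) + 1) ^ 2))).coeff (m - 1 - x.2) * (4 ^ (m - 1 - x.2) * Real.Gamma (((m - 1 - x.2 : ℕ) : ℝ) + 1 / 2) / 2) else 0)) * t ^ (((n : ℕ) : ℝ) - m + 1 / 2)) (m + N + 1)]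
  have hinv : t ^ (1 / 2 - (m : ℝ)) * t ^ ((m : ℝ) - 1 / 2) = 1 := by
    rw [← Real.rpow_add ht, show 1 / 2 - (m : ℝ) + ((m : ℝ) - 1 / 2) = 0 by ring, Real.rpow_zero]
  rw [mul_sub, Finset.mul_sum]
  congr 1
  · simp only [hV, hc]
    calc (2 * (m : ℝ) - 1) * t ^ (1 / 2 - (m : ℝ)) * (rexp ((2 * (m : ℝ) - 1) ^ 2 / 4 * t) * (t ^ ((m : ℝ) - 1 / 2) *
          ∑' n : ℕ, p.eval ((2 * (n : ℝ) + 1) ^ 2) * rexp (-(t / 4 * (2 * (n : ℝ) + 1) ^ 2))))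
        = (2 * (m : ℝ) - 1) * rexp ((2 * (m : ℝ) - 1) ^ 2 / 4 * t) *
          (∑' n : ℕ, p.eval ((2 * (n : ℝ) + 1) ^ 2) * rexp (-(t / 4 * (2 * (n : ℝ) + 1) ^ 2))) *
          (t ^ (1 / 2 - (m : ℝ)) * t ^ ((m : ℝ) - 1 / 2)) := by ring
      _ = _ := by rw [hinv, mul_one]
  · refine Finset.sum_congr rfl fun k _ ↦ ?_
    rw [show t ^ (((k : ℕ) : ℝ) - m + 1 / 2) = t ^ (1 / 2 - (m : ℝ)) * t ^ (k : ℕ) by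
      rw [← Real.rpow_natCast t k, ← Real.rpow_add ht]; ring_nf]
    simp only [hq, hc, ← hp]
    ring

/-- **`Z_N(t) − Z_D(t) − (2m−1)e^{(2m−1)²t/4}∑_{i<m} p_{m,i}·½4ⁱΓ(i+½)·t^{−(i+½)} = O(t^β)` for EVERY `β`** — the boundary
contributions of the two problems are opposite and, up to `O(t^∞)`, a CLOSED FORM (finitely many half-integer powers times
`e^{(2m−1)²t/4}`); `m = 1`: `(√π/2)e^{t/4}t^{−1/2}` (row g40-#3). [cite: McKeanSinger1967, eq. (6) p. 45 (the `±¼√(4πt) ×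
area B` term); Berard1986, Ch. V nº6 (ii)] -/
theorem isBigO_neumannEvenHemisphere_sub_dirichletEvenHemisphere (m : ℕ) (hm : 1 ≤ m) (β : ℝ) :
    (fun t : ℝ ↦ ∑' i : (Σ l : ℕ, Fin ((l + 2 * m - 1).choose (2 * m - 1))), rexp (-(t * ((i.1 : ℝ) * (i.1 + 2 * m - 1)))) - ∑' i : (Σ l : ℕ, Fin ((l + 2 * m - 2).choose (2 * m - 1))), rexp (-(t * ((i.1 : ℝ) * (i.1 + 2 * m - 1)))) -
      (2 * (m : ℝ) - 1) * rexp ((2 * (m : ℝ) - 1) ^ 2 / 4 * t) *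
        ∑ i ∈ Finset.range m, (C (1 / (4 ^ (m - 1) * ((2 * m - 1).factorial : ℝ))) *
          ∏ i ∈ Finset.range (m - 1), (X - C ((2 * (i : ℝ) + 1) ^ 2))).coeff i * (4 ^ i * Real.Gamma ((i : ℝ) + 1 / 2) / 2) * t ^ (-((i : ℝ) + 1 / 2)))
      =O[𝓝[>] 0] fun t : ℝ ↦ t ^ β := by
  have hE : (fun t : ℝ ↦ (2 * (m : ℝ) - 1) * rexp ((2 * (m : ℝ) - 1) ^ 2 / 4 * t)) =O[𝓝[>] 0] fun _ : ℝ ↦ (1 : ℝ) :=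
    (((by fun_prop : Continuous fun t : ℝ ↦ (2 * (m : ℝ) - 1) * rexp ((2 * (m : ℝ) - 1) ^ 2 / 4 * t)).tendsto 0).isBigO_one
      ℝ).mono nhdsWithin_le_nhds
  have h := hE.mul (isBigO_evenSphereBoundaryTheta_sub m hm β)
  simp only [one_mul] at h
  refine h.congr' ?_ EventuallyEq.rfl
  filter_upwards [self_mem_nhdsWithin] with t (ht : 0 < t)
  rw [tsum_neumannEvenHemisphere_sub_tsum_dirichletEvenHemisphere m hm ht,
    (hasSum_evenHemisphere_boundary_multiplicity m hm ht).tsum_eq]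
  ring

/-- The common core of both expansions: `½(Z_{S^{2m}}(t) + εE_m(t)) − ∑_{k ∈ Fin(m+N+1) ⊕ Fin(m+N+1)}[½A_{m,n}t^{n−m} |
ε·½B_{m,n}t^{n−m+½}] = O(t^{N+1})` for every real `ε`. [cite: McKeanSinger1967, eq. (6) p. 45; Berard1986, Ch. VII nº2
Theorem (ii)] -/
private theorem isBigO_half_evenSphere_add_mul_boundary_sub (m : ℕ) (hm : 1 ≤ m) (ε : ℝ) (N : ℕ) :
    (fun t : ℝ ↦ 1 / 2 * ((∑' i : (Σ l : ℕ, Fin ((l + 2 * m - 1).choose (2 * m - 1) + (l + 2 * m - 2).choose (2 * m - 1))), rexp (-(t * ((i.1 : ℝ) * (i.1 + 2 * m - 1))))) +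
        ε * ∑' l : ℕ, (((l + 2 * m - 2).choose (2 * m - 2) : ℕ) : ℝ) * rexp (-(t * ((l : ℝ) * (l + 2 * m - 1))))) -
      ∑ k : Fin (m + N + 1) ⊕ Fin (m + N + 1), Sum.elim (fun n : Fin (m + N + 1) ↦ (∑ x ∈ Finset.HasAntidiagonal.antidiagonal (n : ℕ), ((2 * (m : ℝ) - 1) ^ 2 / 4) ^ x.1 / (x.1.factorial : ℝ) *
        (if x.2 < m then (C (1 / (4 ^ (m - 1) * ((2 * m - 1).factorial : ℝ))) *
          ∏ i ∈ Finset.range (m - 1), (X - C ((2 * (i : ℝ) + 1) ^ 2))).coeff (m - 1 - x.2) * (4 ^ (m - 1 - x.2) * ((m - 1 - x.2).factorial : ℝ))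
        else ∑ k ∈ Finset.range m, (C (1 / (4 ^ (m - 1) * ((2 * m - 1).factorial : ℝ))) *
          ∏ i ∈ Finset.range (m - 1), (X - C ((2 * (i : ℝ) + 1) ^ 2))).coeff k * (((1 / 4 : ℝ) ^ (x.2 - m) - 2 ^ (2 * k + 1)) *
          ((-1 : ℝ) ^ (x.2 - m + 1) * (bernoulli (2 * (k + (x.2 - m) + 1)) : ℝ) /
            (2 * ((k + (x.2 - m) + 1 : ℕ) : ℝ) * ((x.2 - m).factorial : ℝ)))))) / 2)
          (fun n : Fin (m + N + 1) ↦ ε * ((2 * (m : ℝ) - 1) * ∑ x ∈ Finset.HasAntidiagonal.antidiagonal (n : ℕ), ((2 * (m : ℝ) - 1) ^ 2 / 4) ^ x.1 / (x.1.factorial : ℝ) *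
        (if x.2 < m then (C (1 / (4 ^ (m - 1) * ((2 * m - 1).factorial : ℝ))) *
          ∏ i ∈ Finset.range (m - 1), (X - C ((2 * (i : ℝ) + 1) ^ 2))).coeff (m - 1 - x.2) * (4 ^ (m - 1 - x.2) * Real.Gamma (((m - 1 - x.2 : ℕ) : ℝ) + 1 / 2) / 2) else 0)) / 2) k * t ^ (Sum.elim (fun n : Fin (m + N + 1) ↦ ((n : ℕ) : ℝ) - m) (fun n : Fin (m + N + 1) ↦ ((n : ℕ) : ℝ) - m + 1 / 2) k)) =O[𝓝[>] 0] fun t : ℝ ↦ t ^ ((N : ℝ) + 1) := by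
  have hS := isBigO_evenSphere_heatTrace_expansion m hm N
  have hB0 := isBigO_evenHemisphere_boundary_expansion m hm N
  have h32 : (fun t : ℝ ↦ t ^ ((N : ℝ) + 3 / 2)) =O[𝓝[>] 0] fun t : ℝ ↦ t ^ ((N : ℝ) + 1) := by
    refine IsBigO.of_bound 1 ?_
    filter_upwards [Ioc_mem_nhdsGT (zero_lt_one' ℝ)] with t ht
    rw [Real.norm_of_nonneg (Real.rpow_nonneg ht.1.le _), Real.norm_of_nonneg (Real.rpow_nonneg ht.1.le _), one_mul]
    exact Real.rpow_le_rpow_of_exponent_ge ht.1 ht.2 (by linarith)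
  have hB := hB0.trans h32
  have h := (hS.const_mul_left (1 / 2)).add (hB.const_mul_left (ε / 2))
  refine h.congr' ?_ EventuallyEq.rfl
  filter_upwards [self_mem_nhdsWithin] with t (ht : 0 < t)
  rw [Fintype.sum_sum_type]
  simp only [Sum.elim_inl, Sum.elim_inr]
  have e1 : ∀ n : Fin (m + N + 1), (∑ x ∈ Finset.HasAntidiagonal.antidiagonal (n : ℕ), ((2 * (m : ℝ) - 1) ^ 2 / 4) ^ x.1 / (x.1.factorial : ℝ) *
        (if x.2 < m then (C (1 / (4 ^ (m - 1) * ((2 * m - 1).factorial : ℝ))) *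
          ∏ i ∈ Finset.range (m - 1), (X - C ((2 * (i : ℝ) + 1) ^ 2))).coeff (m - 1 - x.2) * (4 ^ (m - 1 - x.2) * ((m - 1 - x.2).factorial : ℝ))
        else ∑ k ∈ Finset.range m, (C (1 / (4 ^ (m - 1) * ((2 * m - 1).factorial : ℝ))) *
          ∏ i ∈ Finset.range (m - 1), (X - C ((2 * (i : ℝ) + 1) ^ 2))).coeff k * (((1 / 4 : ℝ) ^ (x.2 - m) - 2 ^ (2 * k + 1)) *
          ((-1 : ℝ) ^ (x.2 - m + 1) * (bernoulli (2 * (k + (x.2 - m) + 1)) : ℝ) /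
            (2 * ((k + (x.2 - m) + 1 : ℕ) : ℝ) * ((x.2 - m).factorial : ℝ)))))) / 2 * t ^ (((n : ℕ) : ℝ) - m) = 1 / 2 * ((∑ x ∈ Finset.HasAntidiagonal.antidiagonal (n : ℕ), ((2 * (m : ℝ) - 1) ^ 2 / 4) ^ x.1 / (x.1.factorial : ℝ) *
        (if x.2 < m then (C (1 / (4 ^ (m - 1) * ((2 * m - 1).factorial : ℝ))) *
          ∏ i ∈ Finset.range (m - 1), (X - C ((2 * (i : ℝ) + 1) ^ 2))).coeff (m - 1 - x.2) * (4 ^ (m - 1 - x.2) * ((m - 1 - x.2).factorial : ℝ))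
        else ∑ k ∈ Finset.range m, (C (1 / (4 ^ (m - 1) * ((2 * m - 1).factorial : ℝ))) *
          ∏ i ∈ Finset.range (m - 1), (X - C ((2 * (i : ℝ) + 1) ^ 2))).coeff k * (((1 / 4 : ℝ) ^ (x.2 - m) - 2 ^ (2 * k + 1)) *
          ((-1 : ℝ) ^ (x.2 - m + 1) * (bernoulli (2 * (k + (x.2 - m) + 1)) : ℝ) /
            (2 * ((k + (x.2 - m) + 1 : ℕ) : ℝ) * ((x.2 - m).factorial : ℝ)))))) * t ^ (((n : ℕ) : ℝ) - m)) :=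
    fun n ↦ by ring
  have e2 : ∀ n : Fin (m + N + 1), ε * ((2 * (m : ℝ) - 1) * ∑ x ∈ Finset.HasAntidiagonal.antidiagonal (n : ℕ), ((2 * (m : ℝ) - 1) ^ 2 / 4) ^ x.1 / (x.1.factorial : ℝ) *
        (if x.2 < m then (C (1 / (4 ^ (m - 1) * ((2 * m - 1).factorial : ℝ))) *
          ∏ i ∈ Finset.range (m - 1), (X - C ((2 * (i : ℝ) + 1) ^ 2))).coeff (m - 1 - x.2) * (4 ^ (m - 1 - x.2) * Real.Gamma (((m - 1 - x.2 : ℕ) : ℝ) + 1 / 2) / 2) else 0)) / 2 * t ^ (((n : ℕ) : ℝ) - m + 1 / 2) =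
      ε / 2 * (((2 * (m : ℝ) - 1) * ∑ x ∈ Finset.HasAntidiagonal.antidiagonal (n : ℕ), ((2 * (m : ℝ) - 1) ^ 2 / 4) ^ x.1 / (x.1.factorial : ℝ) *
        (if x.2 < m then (C (1 / (4 ^ (m - 1) * ((2 * m - 1).factorial : ℝ))) *
          ∏ i ∈ Finset.range (m - 1), (X - C ((2 * (i : ℝ) + 1) ^ 2))).coeff (m - 1 - x.2) * (4 ^ (m - 1 - x.2) * Real.Gamma (((m - 1 - x.2 : ℕ) : ℝ) + 1 / 2) / 2) else 0)) * t ^ (((n : ℕ) : ℝ) - m + 1 / 2)) := fun n ↦ by ring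
  simp only [e1, e2, ← Finset.mul_sum]
  ring

/-- **THE DIRICHLET HEMISPHERE `S^{2m}_+` TO ALL ORDERS, EVERY `m ≥ 1`:
`Z_D(t) − ∑_{k ∈ Fin(m+N+1) ⊕ Fin(m+N+1)} [½A_{m,n}t^{n−m} | −½B_{m,n}t^{n−m+½}] = O(t^{N+1})`** — the integer powers are HALF
the invariants of `S^{2m}` (row g41-#2: `A_{m,0} = (m−1)!/(2m−1)!`, …), the half-integer powers `−½B_{m,n}` come from the
boundary (`−½B_{m,0}t^{−m+½} = −¼√(4πt)·area(S^{2m−1})/(4πt)^m`): McKean–Singer's "(6) `(4πt)^{d/2}Z⁻ = the volume of D −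
¼√(4πt) × the surface area of B + (t/3) × ∫K − (t/6) × ∫_B J + O(t^{3/2})`" for `D = S^{2m}_+` (`J ≡ 0`), continued to all
orders; `m = 1` is row g40-#3 (`1/(2t) − √π/(4√t) + 1/6 − (√π/16)√t + ⋯`). [cite: McKeanSinger1967, eq. (6) p. 45;
FreitasMaoSalavessa2025, §2.2; Berard1986, Ch. VII nº2 Theorem (ii); Kirsten2001, §3.2 eqs. (3.2.19)–(3.2.20)] -/
theorem isBigO_dirichletEvenHemisphere_heatTrace_expansion (m : ℕ) (hm : 1 ≤ m) (N : ℕ) :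
    (fun t : ℝ ↦ ∑' i : (Σ l : ℕ, Fin ((l + 2 * m - 2).choose (2 * m - 1))), rexp (-(t * ((i.1 : ℝ) * (i.1 + 2 * m - 1)))) - ∑ k : Fin (m + N + 1) ⊕ Fin (m + N + 1), Sum.elim (fun n : Fin (m + N + 1) ↦ (∑ x ∈ Finset.HasAntidiagonal.antidiagonal (n : ℕ), ((2 * (m : ℝ) - 1) ^ 2 / 4) ^ x.1 / (x.1.factorial : ℝ) *
        (if x.2 < m then (C (1 / (4 ^ (m - 1) * ((2 * m - 1).factorial : ℝ))) *
          ∏ i ∈ Finset.range (m - 1), (X - C ((2 * (i : ℝ) + 1) ^ 2))).coeff (m - 1 - x.2) * (4 ^ (m - 1 - x.2) * ((m - 1 - x.2).factorial : ℝ))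
        else ∑ k ∈ Finset.range m, (C (1 / (4 ^ (m - 1) * ((2 * m - 1).factorial : ℝ))) *
          ∏ i ∈ Finset.range (m - 1), (X - C ((2 * (i : ℝ) + 1) ^ 2))).coeff k * (((1 / 4 : ℝ) ^ (x.2 - m) - 2 ^ (2 * k + 1)) *
          ((-1 : ℝ) ^ (x.2 - m + 1) * (bernoulli (2 * (k + (x.2 - m) + 1)) : ℝ) /
            (2 * ((k + (x.2 - m) + 1 : ℕ) : ℝ) * ((x.2 - m).factorial : ℝ)))))) / 2)
          (fun n : Fin (m + N + 1) ↦ (-1) * ((2 * (m : ℝ) - 1) * ∑ x ∈ Finset.HasAntidiagonal.antidiagonal (n : ℕ), ((2 * (m : ℝ) - 1) ^ 2 / 4) ^ x.1 / (x.1.factorial : ℝ) *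
        (if x.2 < m then (C (1 / (4 ^ (m - 1) * ((2 * m - 1).factorial : ℝ))) *
          ∏ i ∈ Finset.range (m - 1), (X - C ((2 * (i : ℝ) + 1) ^ 2))).coeff (m - 1 - x.2) * (4 ^ (m - 1 - x.2) * Real.Gamma (((m - 1 - x.2 : ℕ) : ℝ) + 1 / 2) / 2) else 0)) / 2) k * t ^ (Sum.elim (fun n : Fin (m + N + 1) ↦ ((n : ℕ) : ℝ) - m) (fun n : Fin (m + N + 1) ↦ ((n : ℕ) : ℝ) - m + 1 / 2) k)) =O[𝓝[>] 0] fun t : ℝ ↦ t ^ ((N : ℝ) + 1) := by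
  refine (isBigO_half_evenSphere_add_mul_boundary_sub m hm (-1) N).congr' ?_ EventuallyEq.rfl
  filter_upwards [self_mem_nhdsWithin] with t (ht : 0 < t)
  rw [(hasSum_dirichletEvenHemisphere m hm ht).tsum_eq, tsum_evenSphere m hm ht,
    (hasSum_evenHemisphere_boundary_multiplicity m hm ht).tsum_eq]
  ring

/-- **THE NEUMANN HEMISPHERE `S^{2m}_+` TO ALL ORDERS, EVERY `m ≥ 1`:
`Z_N(t) − ∑_{k ∈ Fin(m+N+1) ⊕ Fin(m+N+1)} [½A_{m,n}t^{n−m} | +½B_{m,n}t^{n−m+½}] = O(t^{N+1})`** (McKean–Singer's (6) with the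
upper sign, `Z⁺`). [cite: McKeanSinger1967, eq. (6) p. 45; FreitasMaoSalavessa2025, §1.3; Berard1986, Ch. VII nº2 Theorem (ii);
Kirsten2001, §3.2 eqs. (3.2.19)–(3.2.20)] -/
theorem isBigO_neumannEvenHemisphere_heatTrace_expansion (m : ℕ) (hm : 1 ≤ m) (N : ℕ) :
    (fun t : ℝ ↦ ∑' i : (Σ l : ℕ, Fin ((l + 2 * m - 1).choose (2 * m - 1))), rexp (-(t * ((i.1 : ℝ) * (i.1 + 2 * m - 1)))) - ∑ k : Fin (m + N + 1) ⊕ Fin (m + N + 1), Sum.elim (fun n : Fin (m + N + 1) ↦ (∑ x ∈ Finset.HasAntidiagonal.antidiagonal (n : ℕ), ((2 * (m : ℝ) - 1) ^ 2 / 4) ^ x.1 / (x.1.factorial : ℝ) *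
        (if x.2 < m then (C (1 / (4 ^ (m - 1) * ((2 * m - 1).factorial : ℝ))) *
          ∏ i ∈ Finset.range (m - 1), (X - C ((2 * (i : ℝ) + 1) ^ 2))).coeff (m - 1 - x.2) * (4 ^ (m - 1 - x.2) * ((m - 1 - x.2).factorial : ℝ))
        else ∑ k ∈ Finset.range m, (C (1 / (4 ^ (m - 1) * ((2 * m - 1).factorial : ℝ))) *
          ∏ i ∈ Finset.range (m - 1), (X - C ((2 * (i : ℝ) + 1) ^ 2))).coeff k * (((1 / 4 : ℝ) ^ (x.2 - m) - 2 ^ (2 * k + 1)) *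
          ((-1 : ℝ) ^ (x.2 - m + 1) * (bernoulli (2 * (k + (x.2 - m) + 1)) : ℝ) /
            (2 * ((k + (x.2 - m) + 1 : ℕ) : ℝ) * ((x.2 - m).factorial : ℝ)))))) / 2)
          (fun n : Fin (m + N + 1) ↦ 1 * ((2 * (m : ℝ) - 1) * ∑ x ∈ Finset.HasAntidiagonal.antidiagonal (n : ℕ), ((2 * (m : ℝ) - 1) ^ 2 / 4) ^ x.1 / (x.1.factorial : ℝ) *
        (if x.2 < m then (C (1 / (4 ^ (m - 1) * ((2 * m - 1).factorial : ℝ))) *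
          ∏ i ∈ Finset.range (m - 1), (X - C ((2 * (i : ℝ) + 1) ^ 2))).coeff (m - 1 - x.2) * (4 ^ (m - 1 - x.2) * Real.Gamma (((m - 1 - x.2 : ℕ) : ℝ) + 1 / 2) / 2) else 0)) / 2) k * t ^ (Sum.elim (fun n : Fin (m + N + 1) ↦ ((n : ℕ) : ℝ) - m) (fun n : Fin (m + N + 1) ↦ ((n : ℕ) : ℝ) - m + 1 / 2) k)) =O[𝓝[>] 0] fun t : ℝ ↦ t ^ ((N : ℝ) + 1) := by
  refine (isBigO_half_evenSphere_add_mul_boundary_sub m hm 1 N).congr' ?_ EventuallyEq.rfl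
  filter_upwards [self_mem_nhdsWithin] with t (ht : 0 < t)
  rw [(hasSum_neumannEvenHemisphere m hm ht).tsum_eq, tsum_evenSphere m hm ht,
    (hasSum_evenHemisphere_boundary_multiplicity m hm ht).tsum_eq]
  ring

/-! ### §4 The boundary coefficients: `B_{m,0} = 2√π/(4^m(m−1)!)` (McKean–Singer's `¼√(4π)·(4π)^{−m}·|S^{2m−1}|` doubled),
`m = 1` (row g40-#3), `m = 2` -/

/-- **THE LEADING BOUNDARY COEFFICIENT `B_{m,0} = (2m−1)·p_{m,m−1}·½4^{m−1}Γ(m−½) = Γ(m−½)/(2(2m−2)!) = 2√π/(4^m(m−1)!)`**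
(`p_{m,m−1} = 1/(4^{m−1}(2m−1)!)`, `Γ(m−½) = (2m−3)‼√π/2^{m−1}`, `(2m−2)! = (2m−3)‼(2m−2)‼ = (2m−3)‼2^{m−1}(m−1)!`); `m = 1`:
`√π/2`, `m = 2`: `√π/8`, `m = 3`: `√π/64`. [cite: McKeanSinger1967, eq. (6) p. 45; Kirsten2001, §3.2 eq. (3.2.19)] -/
theorem evenHemisphere_boundaryCoeff_zero (m : ℕ) (hm : 1 ≤ m) :
    ((2 * (m : ℝ) - 1) * ∑ x ∈ Finset.HasAntidiagonal.antidiagonal 0, ((2 * (m : ℝ) - 1) ^ 2 / 4) ^ x.1 / (x.1.factorial : ℝ) *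
        (if x.2 < m then (C (1 / (4 ^ (m - 1) * ((2 * m - 1).factorial : ℝ))) *
          ∏ i ∈ Finset.range (m - 1), (X - C ((2 * (i : ℝ) + 1) ^ 2))).coeff (m - 1 - x.2) * (4 ^ (m - 1 - x.2) * Real.Gamma (((m - 1 - x.2 : ℕ) : ℝ) + 1 / 2) / 2) else 0)) = 2 * √π / (4 ^ m * ((m - 1).factorial : ℝ)) := by
  rw [Finset.Nat.antidiagonal_zero, Finset.sum_singleton]
  simp only [if_pos (show 0 < m by omega), Nat.sub_zero, pow_zero, Nat.factorial_zero, Nat.cast_one, div_one, one_mul,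
    coeff_evenSphere_poly_top]
  obtain ⟨M, rfl⟩ : ∃ M, m = M + 1 := ⟨m - 1, by omega⟩
  simp only [show M + 1 - 1 = M by omega]
  rw [Real.Gamma_nat_add_half M]
  -- `(2M+1)! = (2M+1)(2M−1)‼·2^M·M!`
  have hfac : ((2 * (M + 1) - 1).factorial : ℝ) = (2 * M + 1) * (((2 * M - 1).doubleFactorial : ℕ) : ℝ) *
      (2 ^ M * (M.factorial : ℝ)) := by
    rw [show 2 * (M + 1) - 1 = 2 * M + 1 by omega, Nat.factorial_eq_mul_doubleFactorial, Nat.doubleFactorial_two_mul]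
    rcases Nat.eq_zero_or_pos M with h | h
    · subst h; simp
    · obtain ⟨K, rfl⟩ : ∃ K, M = K + 1 := ⟨M - 1, by omega⟩
      rw [show 2 * (K + 1) + 1 = (2 * K + 1) + 2 by ring, Nat.doubleFactorial_add_two,
        show 2 * (K + 1) - 1 = 2 * K + 1 by omega]
      push_cast
      ring
  rw [hfac]
  have hD : (0 : ℝ) < (((2 * M - 1).doubleFactorial : ℕ) : ℝ) := by exact_mod_cast Nat.doubleFactorial_pos _
  have hMf : (0 : ℝ) < (M.factorial : ℝ) := by positivity
  have h2 : (0 : ℝ) < (2 : ℝ) ^ M := by positivity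
  have h4 : (4 : ℝ) ^ (M + 1) = 4 * (2 ^ M * 2 ^ M) := by
    rw [pow_succ, ← mul_pow]
    norm_num
    ring
  rw [h4]
  push_cast
  field_simp
  ring

/-- **McKEAN–SINGER'S BOUNDARY TERM FOR `S^{2m}_±`: `½B_{m,0} = ¼·(4π)^{1/2}·(4π)^{−m}·|S^{2m−1}|`, `|S^{2m−1}| = 2π^m/(m−1)!`**
("`(4πt)^{d/2}Z± = vol D ± ¼√(4πt) × the surface area of B + ⋯`", `B = ∂S^{2m}_+` the equator; "the volume `|S^d| =
2π^{(d+1)/2}/Γ((d+1)/2)`", `d = 2m−1`). [cite: McKeanSinger1967, eq. (6) p. 45; Kirsten2001, §4.2 (volume of `S^d`)] -/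
theorem evenHemisphere_boundaryCoeff_zero_eq_area (m : ℕ) (hm : 1 ≤ m) :
    ((2 * (m : ℝ) - 1) * ∑ x ∈ Finset.HasAntidiagonal.antidiagonal 0, ((2 * (m : ℝ) - 1) ^ 2 / 4) ^ x.1 / (x.1.factorial : ℝ) *
        (if x.2 < m then (C (1 / (4 ^ (m - 1) * ((2 * m - 1).factorial : ℝ))) *
          ∏ i ∈ Finset.range (m - 1), (X - C ((2 * (i : ℝ) + 1) ^ 2))).coeff (m - 1 - x.2) * (4 ^ (m - 1 - x.2) * Real.Gamma (((m - 1 - x.2 : ℕ) : ℝ) + 1 / 2) / 2) else 0)) / 2 = 1 / 4 * (4 * π) ^ (1 / 2 : ℝ) * ((4 * π) ^ (-(m : ℝ)) * (2 * π ^ m / ((m - 1).factorial : ℝ))) := by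
  rw [evenHemisphere_boundaryCoeff_zero m hm]
  have hπ := Real.pi_pos
  have h412 : (4 : ℝ) ^ (1 / 2 : ℝ) = 2 := by
    rw [show (4 : ℝ) = 2 ^ (2 : ℝ) by norm_num, ← Real.rpow_mul (by norm_num)]; norm_num
  rw [Real.mul_rpow (by norm_num) hπ.le, h412, ← Real.sqrt_eq_rpow, Real.rpow_neg (by positivity), Real.rpow_natCast,
    mul_pow]
  have hf : (0 : ℝ) < ((m - 1).factorial : ℝ) := by positivity
  have hπm : (0 : ℝ) < π ^ m := by positivity
  have h4m : (0 : ℝ) < (4 : ℝ) ^ m := by positivity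
  field_simp
  norm_num

/-- **`m = 1` RECOVERS ROW g40-#3: `B_{1,n} = (√π/2)·(¼)ⁿ/n!`** — `p₁ = 1`, `c = ¼`: `E_1(t) = e^{t/4}·(√π/2)t^{−1/2} +
O(t^∞) = (√π/2)∑ₙ((¼)ⁿ/n!)t^{n−1/2} + O(t^∞)` (there: `E(t) − (√π/2)e^{t/4}t^{−1/2} = O(t^β)`, `Z_{D/N} = 1/(2t) ∓ √π/(4√t) +
1/6 ∓ (√π/16)√t + ⋯`). [cite: McKeanSinger1967, eq. (6) p. 45; FreitasMaoSalavessa2025, §2.2 (`n = 2`)] -/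
theorem evenHemisphere_one_boundaryCoeff (n : ℕ) :
    ((2 * ((1 : ℕ) : ℝ) - 1) * ∑ x ∈ Finset.HasAntidiagonal.antidiagonal n, ((2 * ((1 : ℕ) : ℝ) - 1) ^ 2 / 4) ^ x.1 / (x.1.factorial : ℝ) *
        (if x.2 < 1 then (C (1 / (4 ^ (1 - 1) * ((2 * 1 - 1).factorial : ℝ))) *
          ∏ i ∈ Finset.range (1 - 1), (X - C ((2 * (i : ℝ) + 1) ^ 2))).coeff (1 - 1 - x.2) *
          (4 ^ (1 - 1 - x.2) * Real.Gamma (((1 - 1 - x.2 : ℕ) : ℝ) + 1 / 2) / 2) else 0)) =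
      √π / 2 * ((1 / 4 : ℝ) ^ n / (n.factorial : ℝ)) := by
  rw [evenSphere_poly_one, Finset.sum_eq_single (n, 0)]
  · simp only [Nat.cast_one, show (1 : ℕ) - 1 = 0 from rfl, Nat.lt_one_iff, if_true, coeff_one_zero, pow_zero,
      Nat.cast_zero, zero_add, Real.Gamma_one_half_eq]
    norm_num
    ring
  · intro x hx hne
    rw [Finset.HasAntidiagonal.mem_antidiagonal] at hx
    have hx2 : ¬ x.2 < 1 := by
      intro h
      apply hne
      ext <;> simp <;> omega
    rw [if_neg hx2, mul_zero]
  · intro h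
    exact absurd (Finset.HasAntidiagonal.mem_antidiagonal.mpr (by simp)) h

/-- `p₂`: the coefficient of `X` is `1/24`. [folklore] -/
private theorem coeff_evenSphere_poly_two_one : (C (1 / 24 : ℝ) * (X - C 1)).coeff 1 = 1 / 24 := by
  rw [coeff_C_mul, coeff_sub, coeff_X_one, coeff_C_succ]
  norm_num

/-- `p₂`: the constant coefficient is `−1/24`. [folklore] -/
private theorem coeff_evenSphere_poly_two_zero : (C (1 / 24 : ℝ) * (X - C 1)).coeff 0 = -1 / 24 := by
  rw [coeff_C_mul, coeff_sub, coeff_X_zero, coeff_C_zero]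
  norm_num

/-- **`m = 2`, THE HEMISPHERES OF `S⁴`: `B_{2,0} = √π/8`, `B_{2,1} = 7√π/32`** (`p₂ = (X−1)/24`, `c = 9/4`:
`B_{2,0} = 3·(1/24)·4Γ(3/2)/2 = √π/8 = 2√π/(4²·1!)`, `B_{2,1} = 3(c·√π/24 − √π/48) = 7√π/32`), i.e.
`Z_{D/N}(S⁴_±; t) = 1/(12t²) ∓ (√π/16)t^{−3/2} + 1/(6t) ∓ (7√π/64)t^{−1/2} + 29/180 + ⋯`. [cite: McKeanSinger1967, eq. (6)
p. 45 (`vol(S⁴₊) = 4π²/3`, `area(S³) = 2π²`: `(4πt)^{−2}(4π²/3 ∓ ¼√(4πt)·2π²) = 1/(12t²) ∓ (√π/16)t^{−3/2}`);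
Kirsten2001, §3.2 eq. (3.2.19) (`d = 4`)] -/
theorem evenHemisphere_two_boundaryCoeff :
    ((2 * ((2 : ℕ) : ℝ) - 1) * ∑ x ∈ Finset.HasAntidiagonal.antidiagonal 0, ((2 * ((2 : ℕ) : ℝ) - 1) ^ 2 / 4) ^ x.1 / (x.1.factorial : ℝ) *
        (if x.2 < 2 then (C (1 / (4 ^ (2 - 1) * ((2 * 2 - 1).factorial : ℝ))) *
          ∏ i ∈ Finset.range (2 - 1), (X - C ((2 * (i : ℝ) + 1) ^ 2))).coeff (2 - 1 - x.2) *
          (4 ^ (2 - 1 - x.2) * Real.Gamma (((2 - 1 - x.2 : ℕ) : ℝ) + 1 / 2) / 2) else 0)) = √π / 8 ∧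
    ((2 * ((2 : ℕ) : ℝ) - 1) * ∑ x ∈ Finset.HasAntidiagonal.antidiagonal 1, ((2 * ((2 : ℕ) : ℝ) - 1) ^ 2 / 4) ^ x.1 / (x.1.factorial : ℝ) *
        (if x.2 < 2 then (C (1 / (4 ^ (2 - 1) * ((2 * 2 - 1).factorial : ℝ))) *
          ∏ i ∈ Finset.range (2 - 1), (X - C ((2 * (i : ℝ) + 1) ^ 2))).coeff (2 - 1 - x.2) *
          (4 ^ (2 - 1 - x.2) * Real.Gamma (((2 - 1 - x.2 : ℕ) : ℝ) + 1 / 2) / 2) else 0)) = 7 * √π / 32 := by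
  constructor
  · rw [Finset.Nat.antidiagonal_zero, Finset.sum_singleton]
    simp only [evenSphere_poly_two]
    rw [coeff_evenSphere_poly_two_one, Real.Gamma_nat_add_half 1]
    norm_num [Nat.factorial, Nat.doubleFactorial]
    ring
  · rw [Finset.Nat.sum_antidiagonal_succ, Finset.Nat.antidiagonal_zero, Finset.sum_singleton]
    simp only [evenSphere_poly_two]
    rw [coeff_evenSphere_poly_two_zero, coeff_evenSphere_poly_two_one, Real.Gamma_nat_add_half 0,
      Real.Gamma_nat_add_half 1]
    norm_num [Nat.factorial, Nat.doubleFactorial]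
    ring

/-! ### §5 Consequences through the abstract heat-trace theory: the leading term, Weyl's law, `ζ_D(0) = ½A_{m,m}`,
`ζ_N(0) = ½A_{m,m} − 1`, the top boundary pole `s = m − ½` with residues `∓1/(4(2m−2)!)` -/

/-- Exponent bookkeeping on `Fin M`, integer powers: `n − m = x ↔ n = n₀` when `x + m = n₀ < M`. [folklore] -/
private theorem evenHemisphereExponent_eq_iff (m M : ℕ) {n₀ : ℕ} (hn : n₀ < M) (x : ℝ) (hx : x + m = n₀) (k : Fin M) :
    ((k : ℕ) : ℝ) - m = x ↔ k = ⟨n₀, hn⟩ := by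
  constructor
  · intro h
    ext
    have : ((k : ℕ) : ℝ) = (n₀ : ℝ) := by linarith
    exact_mod_cast this
  · rintro rfl
    simp only
    linarith

/-- … and for the half-integer powers: `n − m + ½ = x ↔ n = n₀` when `x + m − ½ = n₀ < M`. [folklore] -/
private theorem evenHemisphereHalfExponent_eq_iff (m M : ℕ) {n₀ : ℕ} (hn : n₀ < M) (x : ℝ) (hx : x + m - 1 / 2 = n₀)
    (k : Fin M) : ((k : ℕ) : ℝ) - m + 1 / 2 = x ↔ k = ⟨n₀, hn⟩ := by
  constructor
  · intro h
    ext
    have : ((k : ℕ) : ℝ) = (n₀ : ℝ) := by linarith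
    exact_mod_cast this
  · rintro rfl
    simp only
    linarith

/-- A half-integer exponent is never an integer: `n − m + ½ ≠ j`. [folklore] -/
private theorem natCast_sub_add_half_ne_intCast (n m : ℕ) (j : ℤ) : (n : ℝ) - m + 1 / 2 ≠ (j : ℝ) := by
  intro h
  have h2 : ((2 * (n : ℤ) - 2 * m + 1 : ℤ) : ℝ) = ((2 * j : ℤ) : ℝ) := by push_cast; linarith
  have h3 := Int.cast_injective h2
  omega

/-- `n − m + ½ ≠ −m`. [folklore] -/
private theorem natCast_sub_add_half_ne_neg (n m : ℕ) : (n : ℝ) - m + 1 / 2 ≠ -(m : ℝ) := by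
  have h := natCast_sub_add_half_ne_intCast n m (-(m : ℤ))
  push_cast at h
  exact h

/-- `n − m + ½ ≠ 0`. [folklore] -/
private theorem natCast_sub_add_half_ne_zero (n m : ℕ) : (n : ℝ) - m + 1 / 2 ≠ 0 := by
  simpa using natCast_sub_add_half_ne_intCast n m 0

/-- An integer exponent is never `−(m − ½)`. [folklore] -/
private theorem natCast_sub_ne_neg_sub_half (n m : ℕ) : (n : ℝ) - m ≠ -((m : ℝ) - 1 / 2) := by
  intro h
  have h2 : ((2 * (n : ℤ) : ℤ) : ℝ) = ((1 : ℤ) : ℝ) := by push_cast; linarith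
  have h3 := Int.cast_injective h2
  omega

/-- `m − ½ ≠ 0`. [folklore] -/
private theorem natCast_sub_half_ne_zero (m : ℕ) : (m : ℝ) - 1 / 2 ≠ 0 := by
  intro h
  have h2 : ((2 * (m : ℤ) : ℤ) : ℝ) = ((1 : ℤ) : ℝ) := by push_cast; linarith
  have h3 := Int.cast_injective h2
  omega

/-- `Γ(m−½)^{−1}·√π/(4^m(m−1)!) = 1/(4(2m−2)!)` (`Γ(m−½) = (2m−3)‼√π/2^{m−1}`, `(2m−2)! = 2^{m−1}(m−1)!(2m−3)‼`). [folklore] -/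
private theorem inv_Gamma_mul_sqrt_pi_div (m : ℕ) (hm : 1 ≤ m) :
    (Real.Gamma ((m : ℝ) - 1 / 2))⁻¹ * (√π / (4 ^ m * ((m - 1).factorial : ℝ))) = 1 / (4 * ((2 * m - 2).factorial : ℝ)) := by
  obtain ⟨M, rfl⟩ : ∃ M, m = M + 1 := ⟨m - 1, by omega⟩
  have hG : Real.Gamma (((M + 1 : ℕ) : ℝ) - 1 / 2) = ((2 * M - 1).doubleFactorial : ℝ) * √π / 2 ^ M := by
    rw [← Real.Gamma_nat_add_half M]
    congr 1
    push_cast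
    ring
  rw [hG, show M + 1 - 1 = M by omega, show 2 * (M + 1) - 2 = 2 * M by omega]
  have hfac : ((2 * M).factorial : ℝ) = 2 ^ M * (M.factorial : ℝ) * ((2 * M - 1).doubleFactorial : ℝ) := by
    rcases Nat.eq_zero_or_pos M with h | h
    · subst h; simp
    · obtain ⟨K, rfl⟩ : ∃ K, M = K + 1 := ⟨M - 1, by omega⟩
      rw [show 2 * (K + 1) = (2 * K + 1) + 1 by ring, Nat.factorial_eq_mul_doubleFactorial,
        show 2 * K + 1 + 1 = 2 * (K + 1) by ring, Nat.doubleFactorial_two_mul, show 2 * (K + 1) - 1 = 2 * K + 1 by omega]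
      push_cast
      ring
  rw [hfac]
  have hD : (0 : ℝ) < ((2 * M - 1).doubleFactorial : ℝ) := by exact_mod_cast Nat.doubleFactorial_pos _
  have hπ : 0 < √π := Real.sqrt_pos.mpr Real.pi_pos
  have hMf : (0 : ℝ) < (M.factorial : ℝ) := by positivity
  have h4 : (4 : ℝ) ^ (M + 1) = 4 * (2 ^ M * 2 ^ M) := by
    rw [pow_succ, ← mul_pow]
    norm_num
    ring
  rw [h4]
  field_simp

/-- **THE LEADING HEAT INVARIANT OF THE DIRICHLET HEMISPHERE: `t^m·Z_D(t) → ½·(m−1)!/(2m−1)! = (4π)^{−m}·vol(S^{2m}_+)`**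
(`vol(S^{2m}_+) = ½vol(S^{2m})`; the boundary term `t^{−m+½}` is invisible at this order). [cite: Berard1986, Ch. VII nº2
Theorem (ii) (`a₀ = Vol`); McKeanSinger1967, eq. (6) p. 45] -/
theorem tendsto_pow_mul_dirichletEvenHemisphere_heatTrace (m : ℕ) (hm : 1 ≤ m) :
    Tendsto (fun t : ℝ ↦ t ^ (m : ℝ) * ∑' i : (Σ l : ℕ, Fin ((l + 2 * m - 2).choose (2 * m - 1))), rexp (-(t * ((i.1 : ℝ) * (i.1 + 2 * m - 1))))) (𝓝[>] 0)
      (𝓝 (((m - 1).factorial : ℝ) / ((2 * m - 1).factorial : ℝ) / 2)) := by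
  have h := tendsto_rpow_mul_of_expansion (isBigO_dirichletEvenHemisphere_heatTrace_expansion m hm 0) (ρ := (m : ℝ))
    (fun k ↦ by
      rcases k with n | n
      · simp only [Sum.elim_inl]
        linarith [((n : ℕ).cast_nonneg : (0 : ℝ) ≤ (n : ℕ))]
      · simp only [Sum.elim_inr]
        linarith [((n : ℕ).cast_nonneg : (0 : ℝ) ≤ (n : ℕ))])
    (by push_cast; linarith)
  have e : (∑ k : Fin (m + 0 + 1) ⊕ Fin (m + 0 + 1), if Sum.elim (fun n : Fin (m + 0 + 1) ↦ ((n : ℕ) : ℝ) - m) (fun n : Fin (m + 0 + 1) ↦ ((n : ℕ) : ℝ) - m + 1 / 2) k = -(m : ℝ) then Sum.elim (fun n : Fin (m + 0 + 1) ↦ (∑ x ∈ Finset.HasAntidiagonal.antidiagonal (n : ℕ), ((2 * (m : ℝ) - 1) ^ 2 / 4) ^ x.1 / (x.1.factorial : ℝ) *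
        (if x.2 < m then (C (1 / (4 ^ (m - 1) * ((2 * m - 1).factorial : ℝ))) *
          ∏ i ∈ Finset.range (m - 1), (X - C ((2 * (i : ℝ) + 1) ^ 2))).coeff (m - 1 - x.2) * (4 ^ (m - 1 - x.2) * ((m - 1 - x.2).factorial : ℝ))
        else ∑ k ∈ Finset.range m, (C (1 / (4 ^ (m - 1) * ((2 * m - 1).factorial : ℝ))) *
          ∏ i ∈ Finset.range (m - 1), (X - C ((2 * (i : ℝ) + 1) ^ 2))).coeff k * (((1 / 4 : ℝ) ^ (x.2 - m) - 2 ^ (2 * k + 1)) *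
          ((-1 : ℝ) ^ (x.2 - m + 1) * (bernoulli (2 * (k + (x.2 - m) + 1)) : ℝ) /
            (2 * ((k + (x.2 - m) + 1 : ℕ) : ℝ) * ((x.2 - m).factorial : ℝ)))))) / 2)
          (fun n : Fin (m + 0 + 1) ↦ (-1) * ((2 * (m : ℝ) - 1) * ∑ x ∈ Finset.HasAntidiagonal.antidiagonal (n : ℕ), ((2 * (m : ℝ) - 1) ^ 2 / 4) ^ x.1 / (x.1.factorial : ℝ) *
        (if x.2 < m then (C (1 / (4 ^ (m - 1) * ((2 * m - 1).factorial : ℝ))) *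
          ∏ i ∈ Finset.range (m - 1), (X - C ((2 * (i : ℝ) + 1) ^ 2))).coeff (m - 1 - x.2) * (4 ^ (m - 1 - x.2) * Real.Gamma (((m - 1 - x.2 : ℕ) : ℝ) + 1 / 2) / 2) else 0)) / 2) k else 0) =
      ((m - 1).factorial : ℝ) / ((2 * m - 1).factorial : ℝ) / 2 := by
    rw [Fintype.sum_sum_type]
    simp only [Sum.elim_inl, Sum.elim_inr, evenHemisphereExponent_eq_iff m (m + 0 + 1) (show 0 < m + 0 + 1 by omega)
      (-(m : ℝ)) (by push_cast; ring), Finset.sum_ite_eq', Finset.mem_univ, if_true, natCast_sub_add_half_ne_neg _ m,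
      if_false, Finset.sum_const_zero, add_zero]
    rw [evenSphere_heatCoeff_zero m hm]
  rw [e] at h
  exact h

/-- **THE LEADING HEAT INVARIANT OF THE NEUMANN HEMISPHERE: `t^m·Z_N(t) → ½·(m−1)!/(2m−1)!`** (the same volume).
[cite: Berard1986, Ch. VII nº2 Theorem (ii); McKeanSinger1967, eq. (6) p. 45] -/
theorem tendsto_pow_mul_neumannEvenHemisphere_heatTrace (m : ℕ) (hm : 1 ≤ m) :
    Tendsto (fun t : ℝ ↦ t ^ (m : ℝ) * ∑' i : (Σ l : ℕ, Fin ((l + 2 * m - 1).choose (2 * m - 1))), rexp (-(t * ((i.1 : ℝ) * (i.1 + 2 * m - 1))))) (𝓝[>] 0)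
      (𝓝 (((m - 1).factorial : ℝ) / ((2 * m - 1).factorial : ℝ) / 2)) := by
  have h := tendsto_rpow_mul_of_expansion (isBigO_neumannEvenHemisphere_heatTrace_expansion m hm 0) (ρ := (m : ℝ))
    (fun k ↦ by
      rcases k with n | n
      · simp only [Sum.elim_inl]
        linarith [((n : ℕ).cast_nonneg : (0 : ℝ) ≤ (n : ℕ))]
      · simp only [Sum.elim_inr]
        linarith [((n : ℕ).cast_nonneg : (0 : ℝ) ≤ (n : ℕ))])
    (by push_cast; linarith)
  have e : (∑ k : Fin (m + 0 + 1) ⊕ Fin (m + 0 + 1), if Sum.elim (fun n : Fin (m + 0 + 1) ↦ ((n : ℕ) : ℝ) - m) (fun n : Fin (m + 0 + 1) ↦ ((n : ℕ) : ℝ) - m + 1 / 2) k = -(m : ℝ) then Sum.elim (fun n : Fin (m + 0 + 1) ↦ (∑ x ∈ Finset.HasAntidiagonal.antidiagonal (n : ℕ), ((2 * (m : ℝ) - 1) ^ 2 / 4) ^ x.1 / (x.1.factorial : ℝ) *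
        (if x.2 < m then (C (1 / (4 ^ (m - 1) * ((2 * m - 1).factorial : ℝ))) *
          ∏ i ∈ Finset.range (m - 1), (X - C ((2 * (i : ℝ) + 1) ^ 2))).coeff (m - 1 - x.2) * (4 ^ (m - 1 - x.2) * ((m - 1 - x.2).factorial : ℝ))
        else ∑ k ∈ Finset.range m, (C (1 / (4 ^ (m - 1) * ((2 * m - 1).factorial : ℝ))) *
          ∏ i ∈ Finset.range (m - 1), (X - C ((2 * (i : ℝ) + 1) ^ 2))).coeff k * (((1 / 4 : ℝ) ^ (x.2 - m) - 2 ^ (2 * k + 1)) *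
          ((-1 : ℝ) ^ (x.2 - m + 1) * (bernoulli (2 * (k + (x.2 - m) + 1)) : ℝ) /
            (2 * ((k + (x.2 - m) + 1 : ℕ) : ℝ) * ((x.2 - m).factorial : ℝ)))))) / 2)
          (fun n : Fin (m + 0 + 1) ↦ 1 * ((2 * (m : ℝ) - 1) * ∑ x ∈ Finset.HasAntidiagonal.antidiagonal (n : ℕ), ((2 * (m : ℝ) - 1) ^ 2 / 4) ^ x.1 / (x.1.factorial : ℝ) *
        (if x.2 < m then (C (1 / (4 ^ (m - 1) * ((2 * m - 1).factorial : ℝ))) *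
          ∏ i ∈ Finset.range (m - 1), (X - C ((2 * (i : ℝ) + 1) ^ 2))).coeff (m - 1 - x.2) * (4 ^ (m - 1 - x.2) * Real.Gamma (((m - 1 - x.2 : ℕ) : ℝ) + 1 / 2) / 2) else 0)) / 2) k else 0) =
      ((m - 1).factorial : ℝ) / ((2 * m - 1).factorial : ℝ) / 2 := by
    rw [Fintype.sum_sum_type]
    simp only [Sum.elim_inl, Sum.elim_inr, evenHemisphereExponent_eq_iff m (m + 0 + 1) (show 0 < m + 0 + 1 by omega)
      (-(m : ℝ)) (by push_cast; ring), Finset.sum_ite_eq', Finset.mem_univ, if_true, natCast_sub_add_half_ne_neg _ m,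
      if_false, Finset.sum_const_zero, add_zero]
    rw [evenSphere_heatCoeff_zero m hm]
  rw [e] at h
  exact h

/-- **WEYL'S LAW FOR THE DIRICHLET HEMISPHERE `S^{2m}_+`: `#{λ ≤ Λ}/Λ^m → ½(m−1)!/((2m−1)!·m!)`** — half the Weyl constant of
`S^{2m}` (`vol(S^{2m}_+) = ½vol(S^{2m})`; "`c_w = (n!)^{2/n}`"); the boundary terms are invisible at Weyl order. [cite:
Berard1986, Ch. VII nº10 (ii) (11); FreitasMaoSalavessa2025, §2.2; McKeanSinger1967, eq. (6) p. 45] -/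
theorem tendsto_ncard_dirichletEvenHemisphere_le_div_rpow (m : ℕ) (hm : 1 ≤ m) :
    Tendsto (fun Λ : ℝ ↦ (({i : (Σ l : ℕ, Fin ((l + 2 * m - 2).choose (2 * m - 1))) | ((i.1 : ℝ) * (i.1 + 2 * m - 1)) ≤ Λ}.ncard : ℕ) : ℝ) / Λ ^ (m : ℝ)) atTop
      (𝓝 (((m - 1).factorial : ℝ) / ((2 * m - 1).factorial : ℝ) / 2 / (m.factorial : ℝ))) := by
  have hexp : (fun t : ℝ ↦ ∑' i : (Σ l : ℕ, Fin ((l + 2 * m - 2).choose (2 * m - 1))), rexp (-(((i.1 : ℝ) * (i.1 + 2 * m - 1)) * t)) - ∑ k : Fin (m + 0 + 1) ⊕ Fin (m + 0 + 1), Sum.elim (fun n : Fin (m + 0 + 1) ↦ (∑ x ∈ Finset.HasAntidiagonal.antidiagonal (n : ℕ), ((2 * (m : ℝ) - 1) ^ 2 / 4) ^ x.1 / (x.1.factorial : ℝ) *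
        (if x.2 < m then (C (1 / (4 ^ (m - 1) * ((2 * m - 1).factorial : ℝ))) *
          ∏ i ∈ Finset.range (m - 1), (X - C ((2 * (i : ℝ) + 1) ^ 2))).coeff (m - 1 - x.2) * (4 ^ (m - 1 - x.2) * ((m - 1 - x.2).factorial : ℝ))
        else ∑ k ∈ Finset.range m, (C (1 / (4 ^ (m - 1) * ((2 * m - 1).factorial : ℝ))) *
          ∏ i ∈ Finset.range (m - 1), (X - C ((2 * (i : ℝ) + 1) ^ 2))).coeff k * (((1 / 4 : ℝ) ^ (x.2 - m) - 2 ^ (2 * k + 1)) *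
          ((-1 : ℝ) ^ (x.2 - m + 1) * (bernoulli (2 * (k + (x.2 - m) + 1)) : ℝ) /
            (2 * ((k + (x.2 - m) + 1 : ℕ) : ℝ) * ((x.2 - m).factorial : ℝ)))))) / 2)
          (fun n : Fin (m + 0 + 1) ↦ (-1) * ((2 * (m : ℝ) - 1) * ∑ x ∈ Finset.HasAntidiagonal.antidiagonal (n : ℕ), ((2 * (m : ℝ) - 1) ^ 2 / 4) ^ x.1 / (x.1.factorial : ℝ) *
        (if x.2 < m then (C (1 / (4 ^ (m - 1) * ((2 * m - 1).factorial : ℝ))) *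
          ∏ i ∈ Finset.range (m - 1), (X - C ((2 * (i : ℝ) + 1) ^ 2))).coeff (m - 1 - x.2) * (4 ^ (m - 1 - x.2) * Real.Gamma (((m - 1 - x.2 : ℕ) : ℝ) + 1 / 2) / 2) else 0)) / 2) k * t ^ (Sum.elim (fun n : Fin (m + 0 + 1) ↦ ((n : ℕ) : ℝ) - m) (fun n : Fin (m + 0 + 1) ↦ ((n : ℕ) : ℝ) - m + 1 / 2) k)) =O[𝓝[>] 0]
      fun t : ℝ ↦ t ^ (((0 : ℕ) : ℝ) + 1) := by
    refine (isBigO_dirichletEvenHemisphere_heatTrace_expansion m hm 0).congr' ?_ EventuallyEq.rfl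
    filter_upwards with t
    congr 1
    exact tsum_congr fun i ↦ by rw [mul_comm]
  have hsum : ∀ t : ℝ, 0 < t → Summable fun i : (Σ l : ℕ, Fin ((l + 2 * m - 2).choose (2 * m - 1))) ↦ rexp (-(((i.1 : ℝ) * (i.1 + 2 * m - 1)) * t)) :=
    fun t ht ↦ (summable_dirichletEvenHemisphere m hm ht).congr fun i ↦ by rw [mul_comm]
  have h := tendsto_ncard_le_div_rpow_of_expansion (μ := fun i : (Σ l : ℕ, Fin ((l + 2 * m - 2).choose (2 * m - 1))) ↦ ((i.1 : ℝ) * (i.1 + 2 * m - 1))) (ρ := (m : ℝ))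
    (fun i ↦ by
      have hm1 : (1 : ℝ) ≤ m := by exact_mod_cast hm
      have hl : (0 : ℝ) ≤ (i.1 : ℝ) := Nat.cast_nonneg _
      show (0 : ℝ) ≤ (i.1 : ℝ) * (i.1 + 2 * m - 1)
      nlinarith) hsum hexp
    (fun k ↦ by
      rcases k with n | n
      · simp only [Sum.elim_inl]
        linarith [((n : ℕ).cast_nonneg : (0 : ℝ) ≤ (n : ℕ))]
      · simp only [Sum.elim_inr]
        linarith [((n : ℕ).cast_nonneg : (0 : ℝ) ≤ (n : ℕ))])
    (by push_cast; linarith) (by positivity)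
  have e : (∑ k : Fin (m + 0 + 1) ⊕ Fin (m + 0 + 1), if Sum.elim (fun n : Fin (m + 0 + 1) ↦ ((n : ℕ) : ℝ) - m) (fun n : Fin (m + 0 + 1) ↦ ((n : ℕ) : ℝ) - m + 1 / 2) k = -(m : ℝ) then Sum.elim (fun n : Fin (m + 0 + 1) ↦ (∑ x ∈ Finset.HasAntidiagonal.antidiagonal (n : ℕ), ((2 * (m : ℝ) - 1) ^ 2 / 4) ^ x.1 / (x.1.factorial : ℝ) *
        (if x.2 < m then (C (1 / (4 ^ (m - 1) * ((2 * m - 1).factorial : ℝ))) *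
          ∏ i ∈ Finset.range (m - 1), (X - C ((2 * (i : ℝ) + 1) ^ 2))).coeff (m - 1 - x.2) * (4 ^ (m - 1 - x.2) * ((m - 1 - x.2).factorial : ℝ))
        else ∑ k ∈ Finset.range m, (C (1 / (4 ^ (m - 1) * ((2 * m - 1).factorial : ℝ))) *
          ∏ i ∈ Finset.range (m - 1), (X - C ((2 * (i : ℝ) + 1) ^ 2))).coeff k * (((1 / 4 : ℝ) ^ (x.2 - m) - 2 ^ (2 * k + 1)) *
          ((-1 : ℝ) ^ (x.2 - m + 1) * (bernoulli (2 * (k + (x.2 - m) + 1)) : ℝ) /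
            (2 * ((k + (x.2 - m) + 1 : ℕ) : ℝ) * ((x.2 - m).factorial : ℝ)))))) / 2)
          (fun n : Fin (m + 0 + 1) ↦ (-1) * ((2 * (m : ℝ) - 1) * ∑ x ∈ Finset.HasAntidiagonal.antidiagonal (n : ℕ), ((2 * (m : ℝ) - 1) ^ 2 / 4) ^ x.1 / (x.1.factorial : ℝ) *
        (if x.2 < m then (C (1 / (4 ^ (m - 1) * ((2 * m - 1).factorial : ℝ))) *
          ∏ i ∈ Finset.range (m - 1), (X - C ((2 * (i : ℝ) + 1) ^ 2))).coeff (m - 1 - x.2) * (4 ^ (m - 1 - x.2) * Real.Gamma (((m - 1 - x.2 : ℕ) : ℝ) + 1 / 2) / 2) else 0)) / 2) k else 0) /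
      Real.Gamma ((m : ℝ) + 1) = ((m - 1).factorial : ℝ) / ((2 * m - 1).factorial : ℝ) / 2 / (m.factorial : ℝ) := by
    rw [Fintype.sum_sum_type]
    simp only [Sum.elim_inl, Sum.elim_inr, evenHemisphereExponent_eq_iff m (m + 0 + 1) (show 0 < m + 0 + 1 by omega)
      (-(m : ℝ)) (by push_cast; ring), Finset.sum_ite_eq', Finset.mem_univ, if_true, natCast_sub_add_half_ne_neg _ m,
      if_false, Finset.sum_const_zero, add_zero]
    rw [evenSphere_heatCoeff_zero m hm, Real.Gamma_nat_eq_factorial]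
  rw [e] at h
  exact h

/-- **WEYL'S LAW FOR THE NEUMANN HEMISPHERE: `#{λ ≤ Λ}/Λ^m → ½(m−1)!/((2m−1)!·m!)`**. [cite: Berard1986, Ch. VII nº10 (ii) (11);
FreitasMaoSalavessa2025, §1.3] -/
theorem tendsto_ncard_neumannEvenHemisphere_le_div_rpow (m : ℕ) (hm : 1 ≤ m) :
    Tendsto (fun Λ : ℝ ↦ (({i : (Σ l : ℕ, Fin ((l + 2 * m - 1).choose (2 * m - 1))) | ((i.1 : ℝ) * (i.1 + 2 * m - 1)) ≤ Λ}.ncard : ℕ) : ℝ) / Λ ^ (m : ℝ)) atTop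
      (𝓝 (((m - 1).factorial : ℝ) / ((2 * m - 1).factorial : ℝ) / 2 / (m.factorial : ℝ))) := by
  have hexp : (fun t : ℝ ↦ ∑' i : (Σ l : ℕ, Fin ((l + 2 * m - 1).choose (2 * m - 1))), rexp (-(((i.1 : ℝ) * (i.1 + 2 * m - 1)) * t)) - ∑ k : Fin (m + 0 + 1) ⊕ Fin (m + 0 + 1), Sum.elim (fun n : Fin (m + 0 + 1) ↦ (∑ x ∈ Finset.HasAntidiagonal.antidiagonal (n : ℕ), ((2 * (m : ℝ) - 1) ^ 2 / 4) ^ x.1 / (x.1.factorial : ℝ) *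
        (if x.2 < m then (C (1 / (4 ^ (m - 1) * ((2 * m - 1).factorial : ℝ))) *
          ∏ i ∈ Finset.range (m - 1), (X - C ((2 * (i : ℝ) + 1) ^ 2))).coeff (m - 1 - x.2) * (4 ^ (m - 1 - x.2) * ((m - 1 - x.2).factorial : ℝ))
        else ∑ k ∈ Finset.range m, (C (1 / (4 ^ (m - 1) * ((2 * m - 1).factorial : ℝ))) *
          ∏ i ∈ Finset.range (m - 1), (X - C ((2 * (i : ℝ) + 1) ^ 2))).coeff k * (((1 / 4 : ℝ) ^ (x.2 - m) - 2 ^ (2 * k + 1)) *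
          ((-1 : ℝ) ^ (x.2 - m + 1) * (bernoulli (2 * (k + (x.2 - m) + 1)) : ℝ) /
            (2 * ((k + (x.2 - m) + 1 : ℕ) : ℝ) * ((x.2 - m).factorial : ℝ)))))) / 2)
          (fun n : Fin (m + 0 + 1) ↦ 1 * ((2 * (m : ℝ) - 1) * ∑ x ∈ Finset.HasAntidiagonal.antidiagonal (n : ℕ), ((2 * (m : ℝ) - 1) ^ 2 / 4) ^ x.1 / (x.1.factorial : ℝ) *
        (if x.2 < m then (C (1 / (4 ^ (m - 1) * ((2 * m - 1).factorial : ℝ))) *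
          ∏ i ∈ Finset.range (m - 1), (X - C ((2 * (i : ℝ) + 1) ^ 2))).coeff (m - 1 - x.2) * (4 ^ (m - 1 - x.2) * Real.Gamma (((m - 1 - x.2 : ℕ) : ℝ) + 1 / 2) / 2) else 0)) / 2) k * t ^ (Sum.elim (fun n : Fin (m + 0 + 1) ↦ ((n : ℕ) : ℝ) - m) (fun n : Fin (m + 0 + 1) ↦ ((n : ℕ) : ℝ) - m + 1 / 2) k)) =O[𝓝[>] 0]
      fun t : ℝ ↦ t ^ (((0 : ℕ) : ℝ) + 1) := by
    refine (isBigO_neumannEvenHemisphere_heatTrace_expansion m hm 0).congr' ?_ EventuallyEq.rfl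
    filter_upwards with t
    congr 1
    exact tsum_congr fun i ↦ by rw [mul_comm]
  have hsum : ∀ t : ℝ, 0 < t → Summable fun i : (Σ l : ℕ, Fin ((l + 2 * m - 1).choose (2 * m - 1))) ↦ rexp (-(((i.1 : ℝ) * (i.1 + 2 * m - 1)) * t)) :=
    fun t ht ↦ (summable_neumannEvenHemisphere m hm ht).congr fun i ↦ by rw [mul_comm]
  have h := tendsto_ncard_le_div_rpow_of_expansion (μ := fun i : (Σ l : ℕ, Fin ((l + 2 * m - 1).choose (2 * m - 1))) ↦ ((i.1 : ℝ) * (i.1 + 2 * m - 1))) (ρ := (m : ℝ))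
    (fun i ↦ by
      have hm1 : (1 : ℝ) ≤ m := by exact_mod_cast hm
      have hl : (0 : ℝ) ≤ (i.1 : ℝ) := Nat.cast_nonneg _
      show (0 : ℝ) ≤ (i.1 : ℝ) * (i.1 + 2 * m - 1)
      nlinarith) hsum hexp
    (fun k ↦ by
      rcases k with n | n
      · simp only [Sum.elim_inl]
        linarith [((n : ℕ).cast_nonneg : (0 : ℝ) ≤ (n : ℕ))]
      · simp only [Sum.elim_inr]
        linarith [((n : ℕ).cast_nonneg : (0 : ℝ) ≤ (n : ℕ))])
    (by push_cast; linarith) (by positivity)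
  have e : (∑ k : Fin (m + 0 + 1) ⊕ Fin (m + 0 + 1), if Sum.elim (fun n : Fin (m + 0 + 1) ↦ ((n : ℕ) : ℝ) - m) (fun n : Fin (m + 0 + 1) ↦ ((n : ℕ) : ℝ) - m + 1 / 2) k = -(m : ℝ) then Sum.elim (fun n : Fin (m + 0 + 1) ↦ (∑ x ∈ Finset.HasAntidiagonal.antidiagonal (n : ℕ), ((2 * (m : ℝ) - 1) ^ 2 / 4) ^ x.1 / (x.1.factorial : ℝ) *
        (if x.2 < m then (C (1 / (4 ^ (m - 1) * ((2 * m - 1).factorial : ℝ))) *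
          ∏ i ∈ Finset.range (m - 1), (X - C ((2 * (i : ℝ) + 1) ^ 2))).coeff (m - 1 - x.2) * (4 ^ (m - 1 - x.2) * ((m - 1 - x.2).factorial : ℝ))
        else ∑ k ∈ Finset.range m, (C (1 / (4 ^ (m - 1) * ((2 * m - 1).factorial : ℝ))) *
          ∏ i ∈ Finset.range (m - 1), (X - C ((2 * (i : ℝ) + 1) ^ 2))).coeff k * (((1 / 4 : ℝ) ^ (x.2 - m) - 2 ^ (2 * k + 1)) *
          ((-1 : ℝ) ^ (x.2 - m + 1) * (bernoulli (2 * (k + (x.2 - m) + 1)) : ℝ) /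
            (2 * ((k + (x.2 - m) + 1 : ℕ) : ℝ) * ((x.2 - m).factorial : ℝ)))))) / 2)
          (fun n : Fin (m + 0 + 1) ↦ 1 * ((2 * (m : ℝ) - 1) * ∑ x ∈ Finset.HasAntidiagonal.antidiagonal (n : ℕ), ((2 * (m : ℝ) - 1) ^ 2 / 4) ^ x.1 / (x.1.factorial : ℝ) *
        (if x.2 < m then (C (1 / (4 ^ (m - 1) * ((2 * m - 1).factorial : ℝ))) *
          ∏ i ∈ Finset.range (m - 1), (X - C ((2 * (i : ℝ) + 1) ^ 2))).coeff (m - 1 - x.2) * (4 ^ (m - 1 - x.2) * Real.Gamma (((m - 1 - x.2 : ℕ) : ℝ) + 1 / 2) / 2) else 0)) / 2) k else 0) /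
      Real.Gamma ((m : ℝ) + 1) = ((m - 1).factorial : ℝ) / ((2 * m - 1).factorial : ℝ) / 2 / (m.factorial : ℝ) := by
    rw [Fintype.sum_sum_type]
    simp only [Sum.elim_inl, Sum.elim_inr, evenHemisphereExponent_eq_iff m (m + 0 + 1) (show 0 < m + 0 + 1 by omega)
      (-(m : ℝ)) (by push_cast; ring), Finset.sum_ite_eq', Finset.mem_univ, if_true, natCast_sub_add_half_ne_neg _ m,
      if_false, Finset.sum_const_zero, add_zero]
    rw [evenSphere_heatCoeff_zero m hm, Real.Gamma_nat_eq_factorial]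
  rw [e] at h
  exact h

/-- **`ζ_D(0) = ½A_{m,m} − dim ker Δ_D = ½A_{m,m}` FOR THE DIRICHLET HEMISPHERE `S^{2m}_+`** (order-`N` continuation, any `N`):
only the INTEGER power `t⁰` contributes at `s = 0` (the boundary terms sit at half-integer exponents), it carries HALF the
coefficient `A_{m,m}` of the sphere (`ζ_{S^{2m}}(0) = A_{m,m} − 1`, row g41-#2), and there is no zero mode. `m = 1`: `1/6`
(row g40-#3). [cite: Gilkey1995, §1.10 Lemma 1.10.1; McKeanSinger1967, eq. (6) p. 45; FreitasMaoSalavessa2025, §2.2] -/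
theorem tendsto_dirichletEvenHemisphereZeta_continuation_nhdsNE_zero (m : ℕ) (hm : 1 ≤ m) (N : ℕ) :
    Tendsto (fun s : ℂ ↦ (Complex.Gamma s)⁻¹ *
        (∑ k : Fin (m + N + 1) ⊕ Fin (m + N + 1), (((Sum.elim (fun n : Fin (m + N + 1) ↦ (∑ x ∈ Finset.HasAntidiagonal.antidiagonal (n : ℕ), ((2 * (m : ℝ) - 1) ^ 2 / 4) ^ x.1 / (x.1.factorial : ℝ) *
        (if x.2 < m then (C (1 / (4 ^ (m - 1) * ((2 * m - 1).factorial : ℝ))) *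
          ∏ i ∈ Finset.range (m - 1), (X - C ((2 * (i : ℝ) + 1) ^ 2))).coeff (m - 1 - x.2) * (4 ^ (m - 1 - x.2) * ((m - 1 - x.2).factorial : ℝ))
        else ∑ k ∈ Finset.range m, (C (1 / (4 ^ (m - 1) * ((2 * m - 1).factorial : ℝ))) *
          ∏ i ∈ Finset.range (m - 1), (X - C ((2 * (i : ℝ) + 1) ^ 2))).coeff k * (((1 / 4 : ℝ) ^ (x.2 - m) - 2 ^ (2 * k + 1)) *
          ((-1 : ℝ) ^ (x.2 - m + 1) * (bernoulli (2 * (k + (x.2 - m) + 1)) : ℝ) /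
            (2 * ((k + (x.2 - m) + 1 : ℕ) : ℝ) * ((x.2 - m).factorial : ℝ)))))) / 2)
          (fun n : Fin (m + N + 1) ↦ (-1) * ((2 * (m : ℝ) - 1) * ∑ x ∈ Finset.HasAntidiagonal.antidiagonal (n : ℕ), ((2 * (m : ℝ) - 1) ^ 2 / 4) ^ x.1 / (x.1.factorial : ℝ) *
        (if x.2 < m then (C (1 / (4 ^ (m - 1) * ((2 * m - 1).factorial : ℝ))) *
          ∏ i ∈ Finset.range (m - 1), (X - C ((2 * (i : ℝ) + 1) ^ 2))).coeff (m - 1 - x.2) * (4 ^ (m - 1 - x.2) * Real.Gamma (((m - 1 - x.2 : ℕ) : ℝ) + 1 / 2) / 2) else 0)) / 2) k : ℝ)) : ℂ) / (s + ((Sum.elim (fun n : Fin (m + N + 1) ↦ ((n : ℕ) : ℝ) - m) (fun n : Fin (m + N + 1) ↦ ((n : ℕ) : ℝ) - m + 1 / 2) k) : ℝ)) -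
          ({i : (Σ l : ℕ, Fin ((l + 2 * m - 2).choose (2 * m - 1))) | ((i.1 : ℝ) * (i.1 + 2 * m - 1)) = 0}.ncard : ℂ) / s +
        mellin (fun t : ℝ ↦ ((∑' i : {i : (Σ l : ℕ, Fin ((l + 2 * m - 2).choose (2 * m - 1))) | ((i.1 : ℝ) * (i.1 + 2 * m - 1)) ≠ 0},
            rexp (-(t * ((((i : (Σ l : ℕ, Fin ((l + 2 * m - 2).choose (2 * m - 1))))).1 : ℝ) * (((i : (Σ l : ℕ, Fin ((l + 2 * m - 2).choose (2 * m - 1))))).1 + 2 * m - 1)))) : ℝ) : ℂ) -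
          (Ioc 0 1).indicator (fun t : ℝ ↦ ((∑ k : Fin (m + N + 1) ⊕ Fin (m + N + 1), Sum.elim (fun n : Fin (m + N + 1) ↦ (∑ x ∈ Finset.HasAntidiagonal.antidiagonal (n : ℕ), ((2 * (m : ℝ) - 1) ^ 2 / 4) ^ x.1 / (x.1.factorial : ℝ) *
        (if x.2 < m then (C (1 / (4 ^ (m - 1) * ((2 * m - 1).factorial : ℝ))) *
          ∏ i ∈ Finset.range (m - 1), (X - C ((2 * (i : ℝ) + 1) ^ 2))).coeff (m - 1 - x.2) * (4 ^ (m - 1 - x.2) * ((m - 1 - x.2).factorial : ℝ))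
        else ∑ k ∈ Finset.range m, (C (1 / (4 ^ (m - 1) * ((2 * m - 1).factorial : ℝ))) *
          ∏ i ∈ Finset.range (m - 1), (X - C ((2 * (i : ℝ) + 1) ^ 2))).coeff k * (((1 / 4 : ℝ) ^ (x.2 - m) - 2 ^ (2 * k + 1)) *
          ((-1 : ℝ) ^ (x.2 - m + 1) * (bernoulli (2 * (k + (x.2 - m) + 1)) : ℝ) /
            (2 * ((k + (x.2 - m) + 1 : ℕ) : ℝ) * ((x.2 - m).factorial : ℝ)))))) / 2)
          (fun n : Fin (m + N + 1) ↦ (-1) * ((2 * (m : ℝ) - 1) * ∑ x ∈ Finset.HasAntidiagonal.antidiagonal (n : ℕ), ((2 * (m : ℝ) - 1) ^ 2 / 4) ^ x.1 / (x.1.factorial : ℝ) *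
        (if x.2 < m then (C (1 / (4 ^ (m - 1) * ((2 * m - 1).factorial : ℝ))) *
          ∏ i ∈ Finset.range (m - 1), (X - C ((2 * (i : ℝ) + 1) ^ 2))).coeff (m - 1 - x.2) * (4 ^ (m - 1 - x.2) * Real.Gamma (((m - 1 - x.2 : ℕ) : ℝ) + 1 / 2) / 2) else 0)) / 2) k * t ^ (Sum.elim (fun n : Fin (m + N + 1) ↦ ((n : ℕ) : ℝ) - m) (fun n : Fin (m + N + 1) ↦ ((n : ℕ) : ℝ) - m + 1 / 2) k) : ℝ) : ℂ) - ({i : (Σ l : ℕ, Fin ((l + 2 * m - 2).choose (2 * m - 1))) | ((i.1 : ℝ) * (i.1 + 2 * m - 1)) = 0}.ncard : ℂ)) t) s)) (𝓝[≠] 0) (𝓝 ((((∑ x ∈ Finset.HasAntidiagonal.antidiagonal m, ((2 * (m : ℝ) - 1) ^ 2 / 4) ^ x.1 / (x.1.factorial : ℝ) *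
        (if x.2 < m then (C (1 / (4 ^ (m - 1) * ((2 * m - 1).factorial : ℝ))) *
          ∏ i ∈ Finset.range (m - 1), (X - C ((2 * (i : ℝ) + 1) ^ 2))).coeff (m - 1 - x.2) * (4 ^ (m - 1 - x.2) * ((m - 1 - x.2).factorial : ℝ))
        else ∑ k ∈ Finset.range m, (C (1 / (4 ^ (m - 1) * ((2 * m - 1).factorial : ℝ))) *
          ∏ i ∈ Finset.range (m - 1), (X - C ((2 * (i : ℝ) + 1) ^ 2))).coeff k * (((1 / 4 : ℝ) ^ (x.2 - m) - 2 ^ (2 * k + 1)) *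
          ((-1 : ℝ) ^ (x.2 - m + 1) * (bernoulli (2 * (k + (x.2 - m) + 1)) : ℝ) /
            (2 * ((k + (x.2 - m) + 1 : ℕ) : ℝ) * ((x.2 - m).factorial : ℝ)))))) / 2 : ℝ)) : ℂ)) := by
  have h := tendsto_continuation_nhdsNE_zero (μ := fun i : (Σ l : ℕ, Fin ((l + 2 * m - 2).choose (2 * m - 1))) ↦ ((i.1 : ℝ) * (i.1 + 2 * m - 1)))
    (fun i ↦ by
      have hm1 : (1 : ℝ) ≤ m := by exact_mod_cast hm
      have hl : (0 : ℝ) ≤ (i.1 : ℝ) := Nat.cast_nonneg _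
      show (0 : ℝ) ≤ (i.1 : ℝ) * (i.1 + 2 * m - 1)
      nlinarith) (tendsto_dirichletEvenHemisphere_cofinite_atTop m hm) (fun t ht ↦ summable_dirichletEvenHemisphere m hm ht)
    (isBigO_dirichletEvenHemisphere_heatTrace_expansion m hm N) (by positivity)
  have e : ((∑ k : Fin (m + N + 1) ⊕ Fin (m + N + 1), if Sum.elim (fun n : Fin (m + N + 1) ↦ ((n : ℕ) : ℝ) - m) (fun n : Fin (m + N + 1) ↦ ((n : ℕ) : ℝ) - m + 1 / 2) k = 0 then (((Sum.elim (fun n : Fin (m + N + 1) ↦ (∑ x ∈ Finset.HasAntidiagonal.antidiagonal (n : ℕ), ((2 * (m : ℝ) - 1) ^ 2 / 4) ^ x.1 / (x.1.factorial : ℝ) *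
        (if x.2 < m then (C (1 / (4 ^ (m - 1) * ((2 * m - 1).factorial : ℝ))) *
          ∏ i ∈ Finset.range (m - 1), (X - C ((2 * (i : ℝ) + 1) ^ 2))).coeff (m - 1 - x.2) * (4 ^ (m - 1 - x.2) * ((m - 1 - x.2).factorial : ℝ))
        else ∑ k ∈ Finset.range m, (C (1 / (4 ^ (m - 1) * ((2 * m - 1).factorial : ℝ))) *
          ∏ i ∈ Finset.range (m - 1), (X - C ((2 * (i : ℝ) + 1) ^ 2))).coeff k * (((1 / 4 : ℝ) ^ (x.2 - m) - 2 ^ (2 * k + 1)) *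
          ((-1 : ℝ) ^ (x.2 - m + 1) * (bernoulli (2 * (k + (x.2 - m) + 1)) : ℝ) /
            (2 * ((k + (x.2 - m) + 1 : ℕ) : ℝ) * ((x.2 - m).factorial : ℝ)))))) / 2)
          (fun n : Fin (m + N + 1) ↦ (-1) * ((2 * (m : ℝ) - 1) * ∑ x ∈ Finset.HasAntidiagonal.antidiagonal (n : ℕ), ((2 * (m : ℝ) - 1) ^ 2 / 4) ^ x.1 / (x.1.factorial : ℝ) *
        (if x.2 < m then (C (1 / (4 ^ (m - 1) * ((2 * m - 1).factorial : ℝ))) *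
          ∏ i ∈ Finset.range (m - 1), (X - C ((2 * (i : ℝ) + 1) ^ 2))).coeff (m - 1 - x.2) * (4 ^ (m - 1 - x.2) * Real.Gamma (((m - 1 - x.2 : ℕ) : ℝ) + 1 / 2) / 2) else 0)) / 2) k : ℝ)) : ℂ) else 0) -
      ({i : (Σ l : ℕ, Fin ((l + 2 * m - 2).choose (2 * m - 1))) | ((i.1 : ℝ) * (i.1 + 2 * m - 1)) = 0}.ncard : ℂ)) = ((((∑ x ∈ Finset.HasAntidiagonal.antidiagonal m, ((2 * (m : ℝ) - 1) ^ 2 / 4) ^ x.1 / (x.1.factorial : ℝ) *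
        (if x.2 < m then (C (1 / (4 ^ (m - 1) * ((2 * m - 1).factorial : ℝ))) *
          ∏ i ∈ Finset.range (m - 1), (X - C ((2 * (i : ℝ) + 1) ^ 2))).coeff (m - 1 - x.2) * (4 ^ (m - 1 - x.2) * ((m - 1 - x.2).factorial : ℝ))
        else ∑ k ∈ Finset.range m, (C (1 / (4 ^ (m - 1) * ((2 * m - 1).factorial : ℝ))) *
          ∏ i ∈ Finset.range (m - 1), (X - C ((2 * (i : ℝ) + 1) ^ 2))).coeff k * (((1 / 4 : ℝ) ^ (x.2 - m) - 2 ^ (2 * k + 1)) *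
          ((-1 : ℝ) ^ (x.2 - m + 1) * (bernoulli (2 * (k + (x.2 - m) + 1)) : ℝ) /
            (2 * ((k + (x.2 - m) + 1 : ℕ) : ℝ) * ((x.2 - m).factorial : ℝ)))))) / 2 : ℝ)) : ℂ) := by
    rw [Fintype.sum_sum_type]
    simp only [Sum.elim_inl, Sum.elim_inr, evenHemisphereExponent_eq_iff m (m + N + 1) (show m < m + N + 1 by omega) 0
      (by ring), Finset.sum_ite_eq', Finset.mem_univ, if_true, natCast_sub_add_half_ne_zero _ m, if_false,
      Finset.sum_const_zero, add_zero, ncard_setOf_dirichletEvenHemisphere_eq_zero m hm, Nat.cast_zero, sub_zero]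
  rw [e] at h
  exact h

/-- **`ζ_N(0) = ½A_{m,m} − 1` FOR THE NEUMANN HEMISPHERE** (one zero mode, the constants). `m = 1`: `1/6 − 1 = −5/6` (row
g40-#3). [cite: Gilkey1995, §1.10 Lemma 1.10.1 and the remark on the positive semi-definite case; McKeanSinger1967, eq. (6)
p. 45; FreitasMaoSalavessa2025, §1.3] -/
theorem tendsto_neumannEvenHemisphereZeta_continuation_nhdsNE_zero (m : ℕ) (hm : 1 ≤ m) (N : ℕ) :
    Tendsto (fun s : ℂ ↦ (Complex.Gamma s)⁻¹ *
        (∑ k : Fin (m + N + 1) ⊕ Fin (m + N + 1), (((Sum.elim (fun n : Fin (m + N + 1) ↦ (∑ x ∈ Finset.HasAntidiagonal.antidiagonal (n : ℕ), ((2 * (m : ℝ) - 1) ^ 2 / 4) ^ x.1 / (x.1.factorial : ℝ) *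
        (if x.2 < m then (C (1 / (4 ^ (m - 1) * ((2 * m - 1).factorial : ℝ))) *
          ∏ i ∈ Finset.range (m - 1), (X - C ((2 * (i : ℝ) + 1) ^ 2))).coeff (m - 1 - x.2) * (4 ^ (m - 1 - x.2) * ((m - 1 - x.2).factorial : ℝ))
        else ∑ k ∈ Finset.range m, (C (1 / (4 ^ (m - 1) * ((2 * m - 1).factorial : ℝ))) *
          ∏ i ∈ Finset.range (m - 1), (X - C ((2 * (i : ℝ) + 1) ^ 2))).coeff k * (((1 / 4 : ℝ) ^ (x.2 - m) - 2 ^ (2 * k + 1)) *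
          ((-1 : ℝ) ^ (x.2 - m + 1) * (bernoulli (2 * (k + (x.2 - m) + 1)) : ℝ) /
            (2 * ((k + (x.2 - m) + 1 : ℕ) : ℝ) * ((x.2 - m).factorial : ℝ)))))) / 2)
          (fun n : Fin (m + N + 1) ↦ 1 * ((2 * (m : ℝ) - 1) * ∑ x ∈ Finset.HasAntidiagonal.antidiagonal (n : ℕ), ((2 * (m : ℝ) - 1) ^ 2 / 4) ^ x.1 / (x.1.factorial : ℝ) *
        (if x.2 < m then (C (1 / (4 ^ (m - 1) * ((2 * m - 1).factorial : ℝ))) *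
          ∏ i ∈ Finset.range (m - 1), (X - C ((2 * (i : ℝ) + 1) ^ 2))).coeff (m - 1 - x.2) * (4 ^ (m - 1 - x.2) * Real.Gamma (((m - 1 - x.2 : ℕ) : ℝ) + 1 / 2) / 2) else 0)) / 2) k : ℝ)) : ℂ) / (s + ((Sum.elim (fun n : Fin (m + N + 1) ↦ ((n : ℕ) : ℝ) - m) (fun n : Fin (m + N + 1) ↦ ((n : ℕ) : ℝ) - m + 1 / 2) k) : ℝ)) -
          ({i : (Σ l : ℕ, Fin ((l + 2 * m - 1).choose (2 * m - 1))) | ((i.1 : ℝ) * (i.1 + 2 * m - 1)) = 0}.ncard : ℂ) / s +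
        mellin (fun t : ℝ ↦ ((∑' i : {i : (Σ l : ℕ, Fin ((l + 2 * m - 1).choose (2 * m - 1))) | ((i.1 : ℝ) * (i.1 + 2 * m - 1)) ≠ 0},
            rexp (-(t * ((((i : (Σ l : ℕ, Fin ((l + 2 * m - 1).choose (2 * m - 1))))).1 : ℝ) * (((i : (Σ l : ℕ, Fin ((l + 2 * m - 1).choose (2 * m - 1))))).1 + 2 * m - 1)))) : ℝ) : ℂ) -
          (Ioc 0 1).indicator (fun t : ℝ ↦ ((∑ k : Fin (m + N + 1) ⊕ Fin (m + N + 1), Sum.elim (fun n : Fin (m + N + 1) ↦ (∑ x ∈ Finset.HasAntidiagonal.antidiagonal (n : ℕ), ((2 * (m : ℝ) - 1) ^ 2 / 4) ^ x.1 / (x.1.factorial : ℝ) *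
        (if x.2 < m then (C (1 / (4 ^ (m - 1) * ((2 * m - 1).factorial : ℝ))) *
          ∏ i ∈ Finset.range (m - 1), (X - C ((2 * (i : ℝ) + 1) ^ 2))).coeff (m - 1 - x.2) * (4 ^ (m - 1 - x.2) * ((m - 1 - x.2).factorial : ℝ))
        else ∑ k ∈ Finset.range m, (C (1 / (4 ^ (m - 1) * ((2 * m - 1).factorial : ℝ))) *
          ∏ i ∈ Finset.range (m - 1), (X - C ((2 * (i : ℝ) + 1) ^ 2))).coeff k * (((1 / 4 : ℝ) ^ (x.2 - m) - 2 ^ (2 * k + 1)) *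
          ((-1 : ℝ) ^ (x.2 - m + 1) * (bernoulli (2 * (k + (x.2 - m) + 1)) : ℝ) /
            (2 * ((k + (x.2 - m) + 1 : ℕ) : ℝ) * ((x.2 - m).factorial : ℝ)))))) / 2)
          (fun n : Fin (m + N + 1) ↦ 1 * ((2 * (m : ℝ) - 1) * ∑ x ∈ Finset.HasAntidiagonal.antidiagonal (n : ℕ), ((2 * (m : ℝ) - 1) ^ 2 / 4) ^ x.1 / (x.1.factorial : ℝ) *
        (if x.2 < m then (C (1 / (4 ^ (m - 1) * ((2 * m - 1).factorial : ℝ))) *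
          ∏ i ∈ Finset.range (m - 1), (X - C ((2 * (i : ℝ) + 1) ^ 2))).coeff (m - 1 - x.2) * (4 ^ (m - 1 - x.2) * Real.Gamma (((m - 1 - x.2 : ℕ) : ℝ) + 1 / 2) / 2) else 0)) / 2) k * t ^ (Sum.elim (fun n : Fin (m + N + 1) ↦ ((n : ℕ) : ℝ) - m) (fun n : Fin (m + N + 1) ↦ ((n : ℕ) : ℝ) - m + 1 / 2) k) : ℝ) : ℂ) - ({i : (Σ l : ℕ, Fin ((l + 2 * m - 1).choose (2 * m - 1))) | ((i.1 : ℝ) * (i.1 + 2 * m - 1)) = 0}.ncard : ℂ)) t) s)) (𝓝[≠] 0) (𝓝 (((((∑ x ∈ Finset.HasAntidiagonal.antidiagonal m, ((2 * (m : ℝ) - 1) ^ 2 / 4) ^ x.1 / (x.1.factorial : ℝ) *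
        (if x.2 < m then (C (1 / (4 ^ (m - 1) * ((2 * m - 1).factorial : ℝ))) *
          ∏ i ∈ Finset.range (m - 1), (X - C ((2 * (i : ℝ) + 1) ^ 2))).coeff (m - 1 - x.2) * (4 ^ (m - 1 - x.2) * ((m - 1 - x.2).factorial : ℝ))
        else ∑ k ∈ Finset.range m, (C (1 / (4 ^ (m - 1) * ((2 * m - 1).factorial : ℝ))) *
          ∏ i ∈ Finset.range (m - 1), (X - C ((2 * (i : ℝ) + 1) ^ 2))).coeff k * (((1 / 4 : ℝ) ^ (x.2 - m) - 2 ^ (2 * k + 1)) *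
          ((-1 : ℝ) ^ (x.2 - m + 1) * (bernoulli (2 * (k + (x.2 - m) + 1)) : ℝ) /
            (2 * ((k + (x.2 - m) + 1 : ℕ) : ℝ) * ((x.2 - m).factorial : ℝ)))))) / 2 : ℝ)) : ℂ) - 1)) := by
  have h := tendsto_continuation_nhdsNE_zero (μ := fun i : (Σ l : ℕ, Fin ((l + 2 * m - 1).choose (2 * m - 1))) ↦ ((i.1 : ℝ) * (i.1 + 2 * m - 1)))
    (fun i ↦ by
      have hm1 : (1 : ℝ) ≤ m := by exact_mod_cast hm
      have hl : (0 : ℝ) ≤ (i.1 : ℝ) := Nat.cast_nonneg _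
      show (0 : ℝ) ≤ (i.1 : ℝ) * (i.1 + 2 * m - 1)
      nlinarith) (tendsto_neumannEvenHemisphere_cofinite_atTop m hm) (fun t ht ↦ summable_neumannEvenHemisphere m hm ht)
    (isBigO_neumannEvenHemisphere_heatTrace_expansion m hm N) (by positivity)
  have e : ((∑ k : Fin (m + N + 1) ⊕ Fin (m + N + 1), if Sum.elim (fun n : Fin (m + N + 1) ↦ ((n : ℕ) : ℝ) - m) (fun n : Fin (m + N + 1) ↦ ((n : ℕ) : ℝ) - m + 1 / 2) k = 0 then (((Sum.elim (fun n : Fin (m + N + 1) ↦ (∑ x ∈ Finset.HasAntidiagonal.antidiagonal (n : ℕ), ((2 * (m : ℝ) - 1) ^ 2 / 4) ^ x.1 / (x.1.factorial : ℝ) *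
        (if x.2 < m then (C (1 / (4 ^ (m - 1) * ((2 * m - 1).factorial : ℝ))) *
          ∏ i ∈ Finset.range (m - 1), (X - C ((2 * (i : ℝ) + 1) ^ 2))).coeff (m - 1 - x.2) * (4 ^ (m - 1 - x.2) * ((m - 1 - x.2).factorial : ℝ))
        else ∑ k ∈ Finset.range m, (C (1 / (4 ^ (m - 1) * ((2 * m - 1).factorial : ℝ))) *
          ∏ i ∈ Finset.range (m - 1), (X - C ((2 * (i : ℝ) + 1) ^ 2))).coeff k * (((1 / 4 : ℝ) ^ (x.2 - m) - 2 ^ (2 * k + 1)) *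
          ((-1 : ℝ) ^ (x.2 - m + 1) * (bernoulli (2 * (k + (x.2 - m) + 1)) : ℝ) /
            (2 * ((k + (x.2 - m) + 1 : ℕ) : ℝ) * ((x.2 - m).factorial : ℝ)))))) / 2)
          (fun n : Fin (m + N + 1) ↦ 1 * ((2 * (m : ℝ) - 1) * ∑ x ∈ Finset.HasAntidiagonal.antidiagonal (n : ℕ), ((2 * (m : ℝ) - 1) ^ 2 / 4) ^ x.1 / (x.1.factorial : ℝ) *
        (if x.2 < m then (C (1 / (4 ^ (m - 1) * ((2 * m - 1).factorial : ℝ))) *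
          ∏ i ∈ Finset.range (m - 1), (X - C ((2 * (i : ℝ) + 1) ^ 2))).coeff (m - 1 - x.2) * (4 ^ (m - 1 - x.2) * Real.Gamma (((m - 1 - x.2 : ℕ) : ℝ) + 1 / 2) / 2) else 0)) / 2) k : ℝ)) : ℂ) else 0) -
      ({i : (Σ l : ℕ, Fin ((l + 2 * m - 1).choose (2 * m - 1))) | ((i.1 : ℝ) * (i.1 + 2 * m - 1)) = 0}.ncard : ℂ)) = ((((∑ x ∈ Finset.HasAntidiagonal.antidiagonal m, ((2 * (m : ℝ) - 1) ^ 2 / 4) ^ x.1 / (x.1.factorial : ℝ) *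
        (if x.2 < m then (C (1 / (4 ^ (m - 1) * ((2 * m - 1).factorial : ℝ))) *
          ∏ i ∈ Finset.range (m - 1), (X - C ((2 * (i : ℝ) + 1) ^ 2))).coeff (m - 1 - x.2) * (4 ^ (m - 1 - x.2) * ((m - 1 - x.2).factorial : ℝ))
        else ∑ k ∈ Finset.range m, (C (1 / (4 ^ (m - 1) * ((2 * m - 1).factorial : ℝ))) *
          ∏ i ∈ Finset.range (m - 1), (X - C ((2 * (i : ℝ) + 1) ^ 2))).coeff k * (((1 / 4 : ℝ) ^ (x.2 - m) - 2 ^ (2 * k + 1)) *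
          ((-1 : ℝ) ^ (x.2 - m + 1) * (bernoulli (2 * (k + (x.2 - m) + 1)) : ℝ) /
            (2 * ((k + (x.2 - m) + 1 : ℕ) : ℝ) * ((x.2 - m).factorial : ℝ)))))) / 2 : ℝ)) : ℂ) - 1 := by
    rw [Fintype.sum_sum_type]
    simp only [Sum.elim_inl, Sum.elim_inr, evenHemisphereExponent_eq_iff m (m + N + 1) (show m < m + N + 1 by omega) 0
      (by ring), Finset.sum_ite_eq', Finset.mem_univ, if_true, natCast_sub_add_half_ne_zero _ m, if_false,
      Finset.sum_const_zero, add_zero, ncard_setOf_neumannEvenHemisphere_eq_zero m hm, Nat.cast_one]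
  rw [e] at h
  exact h

/-- **THE TOP BOUNDARY POLE OF THE DIRICHLET HEMISPHERE: `Res_{s = m−½} ζ_D = Γ(m−½)^{−1}·(−½B_{m,0}) = −1/(4(2m−2)!)`** —
the pole a closed manifold does not have, produced by McKean–Singer's `−¼√(4πt)·area(∂)/(4πt)^m`; `m = 1`: `−¼` (row g40-#3),
`m = 2`: `−1/8`. [cite: Gilkey1995, §1.10 Lemma 1.10.1 ("isolated simple poles at `s = (m−n)/d` … residue
`aₙ(P)Γ((m−n)/d)^{−1}`"); McKeanSinger1967, eq. (6) p. 45] -/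
theorem tendsto_sub_mul_dirichletEvenHemisphereZeta_continuation_top (m : ℕ) (hm : 1 ≤ m) (N : ℕ) :
    Tendsto (fun s : ℂ ↦ (s - (((m : ℝ) - 1 / 2 : ℝ) : ℂ)) * ((Complex.Gamma s)⁻¹ *
        (∑ k : Fin (m + N + 1) ⊕ Fin (m + N + 1), (((Sum.elim (fun n : Fin (m + N + 1) ↦ (∑ x ∈ Finset.HasAntidiagonal.antidiagonal (n : ℕ), ((2 * (m : ℝ) - 1) ^ 2 / 4) ^ x.1 / (x.1.factorial : ℝ) *
        (if x.2 < m then (C (1 / (4 ^ (m - 1) * ((2 * m - 1).factorial : ℝ))) *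
          ∏ i ∈ Finset.range (m - 1), (X - C ((2 * (i : ℝ) + 1) ^ 2))).coeff (m - 1 - x.2) * (4 ^ (m - 1 - x.2) * ((m - 1 - x.2).factorial : ℝ))
        else ∑ k ∈ Finset.range m, (C (1 / (4 ^ (m - 1) * ((2 * m - 1).factorial : ℝ))) *
          ∏ i ∈ Finset.range (m - 1), (X - C ((2 * (i : ℝ) + 1) ^ 2))).coeff k * (((1 / 4 : ℝ) ^ (x.2 - m) - 2 ^ (2 * k + 1)) *
          ((-1 : ℝ) ^ (x.2 - m + 1) * (bernoulli (2 * (k + (x.2 - m) + 1)) : ℝ) /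
            (2 * ((k + (x.2 - m) + 1 : ℕ) : ℝ) * ((x.2 - m).factorial : ℝ)))))) / 2)
          (fun n : Fin (m + N + 1) ↦ (-1) * ((2 * (m : ℝ) - 1) * ∑ x ∈ Finset.HasAntidiagonal.antidiagonal (n : ℕ), ((2 * (m : ℝ) - 1) ^ 2 / 4) ^ x.1 / (x.1.factorial : ℝ) *
        (if x.2 < m then (C (1 / (4 ^ (m - 1) * ((2 * m - 1).factorial : ℝ))) *
          ∏ i ∈ Finset.range (m - 1), (X - C ((2 * (i : ℝ) + 1) ^ 2))).coeff (m - 1 - x.2) * (4 ^ (m - 1 - x.2) * Real.Gamma (((m - 1 - x.2 : ℕ) : ℝ) + 1 / 2) / 2) else 0)) / 2) k : ℝ)) : ℂ) / (s + ((Sum.elim (fun n : Fin (m + N + 1) ↦ ((n : ℕ) : ℝ) - m) (fun n : Fin (m + N + 1) ↦ ((n : ℕ) : ℝ) - m + 1 / 2) k) : ℝ)) -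
          ({i : (Σ l : ℕ, Fin ((l + 2 * m - 2).choose (2 * m - 1))) | ((i.1 : ℝ) * (i.1 + 2 * m - 1)) = 0}.ncard : ℂ) / s +
        mellin (fun t : ℝ ↦ ((∑' i : {i : (Σ l : ℕ, Fin ((l + 2 * m - 2).choose (2 * m - 1))) | ((i.1 : ℝ) * (i.1 + 2 * m - 1)) ≠ 0},
            rexp (-(t * ((((i : (Σ l : ℕ, Fin ((l + 2 * m - 2).choose (2 * m - 1))))).1 : ℝ) * (((i : (Σ l : ℕ, Fin ((l + 2 * m - 2).choose (2 * m - 1))))).1 + 2 * m - 1)))) : ℝ) : ℂ) -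
          (Ioc 0 1).indicator (fun t : ℝ ↦ ((∑ k : Fin (m + N + 1) ⊕ Fin (m + N + 1), Sum.elim (fun n : Fin (m + N + 1) ↦ (∑ x ∈ Finset.HasAntidiagonal.antidiagonal (n : ℕ), ((2 * (m : ℝ) - 1) ^ 2 / 4) ^ x.1 / (x.1.factorial : ℝ) *
        (if x.2 < m then (C (1 / (4 ^ (m - 1) * ((2 * m - 1).factorial : ℝ))) *
          ∏ i ∈ Finset.range (m - 1), (X - C ((2 * (i : ℝ) + 1) ^ 2))).coeff (m - 1 - x.2) * (4 ^ (m - 1 - x.2) * ((m - 1 - x.2).factorial : ℝ))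
        else ∑ k ∈ Finset.range m, (C (1 / (4 ^ (m - 1) * ((2 * m - 1).factorial : ℝ))) *
          ∏ i ∈ Finset.range (m - 1), (X - C ((2 * (i : ℝ) + 1) ^ 2))).coeff k * (((1 / 4 : ℝ) ^ (x.2 - m) - 2 ^ (2 * k + 1)) *
          ((-1 : ℝ) ^ (x.2 - m + 1) * (bernoulli (2 * (k + (x.2 - m) + 1)) : ℝ) /
            (2 * ((k + (x.2 - m) + 1 : ℕ) : ℝ) * ((x.2 - m).factorial : ℝ)))))) / 2)
          (fun n : Fin (m + N + 1) ↦ (-1) * ((2 * (m : ℝ) - 1) * ∑ x ∈ Finset.HasAntidiagonal.antidiagonal (n : ℕ), ((2 * (m : ℝ) - 1) ^ 2 / 4) ^ x.1 / (x.1.factorial : ℝ) *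
        (if x.2 < m then (C (1 / (4 ^ (m - 1) * ((2 * m - 1).factorial : ℝ))) *
          ∏ i ∈ Finset.range (m - 1), (X - C ((2 * (i : ℝ) + 1) ^ 2))).coeff (m - 1 - x.2) * (4 ^ (m - 1 - x.2) * Real.Gamma (((m - 1 - x.2 : ℕ) : ℝ) + 1 / 2) / 2) else 0)) / 2) k * t ^ (Sum.elim (fun n : Fin (m + N + 1) ↦ ((n : ℕ) : ℝ) - m) (fun n : Fin (m + N + 1) ↦ ((n : ℕ) : ℝ) - m + 1 / 2) k) : ℝ) : ℂ) - ({i : (Σ l : ℕ, Fin ((l + 2 * m - 2).choose (2 * m - 1))) | ((i.1 : ℝ) * (i.1 + 2 * m - 1)) = 0}.ncard : ℂ)) t) s))) (𝓝[≠] (((m : ℝ) - 1 / 2 : ℝ) : ℂ))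
      (𝓝 (-(1 / (4 * ((2 * m - 2).factorial : ℂ))))) := by
  have hs₀ : -((N : ℝ) + 1) < (m : ℝ) - 1 / 2 := by
    have hm1 : (1 : ℝ) ≤ m := by exact_mod_cast hm
    linarith [(N.cast_nonneg : (0 : ℝ) ≤ N)]
  have h := tendsto_sub_mul_continuation_nhdsNE (μ := fun i : (Σ l : ℕ, Fin ((l + 2 * m - 2).choose (2 * m - 1))) ↦ ((i.1 : ℝ) * (i.1 + 2 * m - 1)))
    (fun i ↦ by
      have hm1 : (1 : ℝ) ≤ m := by exact_mod_cast hm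
      have hl : (0 : ℝ) ≤ (i.1 : ℝ) := Nat.cast_nonneg _
      show (0 : ℝ) ≤ (i.1 : ℝ) * (i.1 + 2 * m - 1)
      nlinarith) (tendsto_dirichletEvenHemisphere_cofinite_atTop m hm) (fun t ht ↦ summable_dirichletEvenHemisphere m hm ht)
    (isBigO_dirichletEvenHemisphere_heatTrace_expansion m hm N) hs₀
  have e : (Complex.Gamma (((m : ℝ) - 1 / 2 : ℝ) : ℂ))⁻¹ *
      ((∑ k : Fin (m + N + 1) ⊕ Fin (m + N + 1), if Sum.elim (fun n : Fin (m + N + 1) ↦ ((n : ℕ) : ℝ) - m) (fun n : Fin (m + N + 1) ↦ ((n : ℕ) : ℝ) - m + 1 / 2) k = -((m : ℝ) - 1 / 2) then (((Sum.elim (fun n : Fin (m + N + 1) ↦ (∑ x ∈ Finset.HasAntidiagonal.antidiagonal (n : ℕ), ((2 * (m : ℝ) - 1) ^ 2 / 4) ^ x.1 / (x.1.factorial : ℝ) *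
        (if x.2 < m then (C (1 / (4 ^ (m - 1) * ((2 * m - 1).factorial : ℝ))) *
          ∏ i ∈ Finset.range (m - 1), (X - C ((2 * (i : ℝ) + 1) ^ 2))).coeff (m - 1 - x.2) * (4 ^ (m - 1 - x.2) * ((m - 1 - x.2).factorial : ℝ))
        else ∑ k ∈ Finset.range m, (C (1 / (4 ^ (m - 1) * ((2 * m - 1).factorial : ℝ))) *
          ∏ i ∈ Finset.range (m - 1), (X - C ((2 * (i : ℝ) + 1) ^ 2))).coeff k * (((1 / 4 : ℝ) ^ (x.2 - m) - 2 ^ (2 * k + 1)) *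
          ((-1 : ℝ) ^ (x.2 - m + 1) * (bernoulli (2 * (k + (x.2 - m) + 1)) : ℝ) /
            (2 * ((k + (x.2 - m) + 1 : ℕ) : ℝ) * ((x.2 - m).factorial : ℝ)))))) / 2)
          (fun n : Fin (m + N + 1) ↦ (-1) * ((2 * (m : ℝ) - 1) * ∑ x ∈ Finset.HasAntidiagonal.antidiagonal (n : ℕ), ((2 * (m : ℝ) - 1) ^ 2 / 4) ^ x.1 / (x.1.factorial : ℝ) *
        (if x.2 < m then (C (1 / (4 ^ (m - 1) * ((2 * m - 1).factorial : ℝ))) *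
          ∏ i ∈ Finset.range (m - 1), (X - C ((2 * (i : ℝ) + 1) ^ 2))).coeff (m - 1 - x.2) * (4 ^ (m - 1 - x.2) * Real.Gamma (((m - 1 - x.2 : ℕ) : ℝ) + 1 / 2) / 2) else 0)) / 2) k : ℝ)) : ℂ) else 0) -
        if (m : ℝ) - 1 / 2 = 0 then ({i : (Σ l : ℕ, Fin ((l + 2 * m - 2).choose (2 * m - 1))) | ((i.1 : ℝ) * (i.1 + 2 * m - 1)) = 0}.ncard : ℂ) else 0) = -(1 / (4 * ((2 * m - 2).factorial : ℂ))) := by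
    rw [Fintype.sum_sum_type]
    simp only [Sum.elim_inl, Sum.elim_inr, natCast_sub_ne_neg_sub_half _ m, if_false, Finset.sum_const_zero, zero_add,
      evenHemisphereHalfExponent_eq_iff m (m + N + 1) (show 0 < m + N + 1 by omega) (-((m : ℝ) - 1 / 2)) (by push_cast; ring),
      Finset.sum_ite_eq', Finset.mem_univ, if_true, natCast_sub_half_ne_zero m, sub_zero, Complex.Gamma_ofReal]
    rw [evenHemisphere_boundaryCoeff_zero m hm, ← Complex.ofReal_inv, ← Complex.ofReal_mul,
      show (Real.Gamma ((m : ℝ) - 1 / 2))⁻¹ * ((-1) * (2 * √π / (4 ^ m * ((m - 1).factorial : ℝ))) / 2) =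
        -((Real.Gamma ((m : ℝ) - 1 / 2))⁻¹ * (√π / (4 ^ m * ((m - 1).factorial : ℝ)))) by ring,
      inv_Gamma_mul_sqrt_pi_div m hm]
    push_cast
    ring
  rw [e] at h
  exact h

/-- **THE TOP BOUNDARY POLE OF THE NEUMANN HEMISPHERE: `Res_{s = m−½} ζ_N = +1/(4(2m−2)!)`** (McKean–Singer's
`+¼√(4πt)·area(∂)`). [cite: Gilkey1995, §1.10 Lemma 1.10.1; McKeanSinger1967, eq. (6) p. 45] -/
theorem tendsto_sub_mul_neumannEvenHemisphereZeta_continuation_top (m : ℕ) (hm : 1 ≤ m) (N : ℕ) :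
    Tendsto (fun s : ℂ ↦ (s - (((m : ℝ) - 1 / 2 : ℝ) : ℂ)) * ((Complex.Gamma s)⁻¹ *
        (∑ k : Fin (m + N + 1) ⊕ Fin (m + N + 1), (((Sum.elim (fun n : Fin (m + N + 1) ↦ (∑ x ∈ Finset.HasAntidiagonal.antidiagonal (n : ℕ), ((2 * (m : ℝ) - 1) ^ 2 / 4) ^ x.1 / (x.1.factorial : ℝ) *
        (if x.2 < m then (C (1 / (4 ^ (m - 1) * ((2 * m - 1).factorial : ℝ))) *
          ∏ i ∈ Finset.range (m - 1), (X - C ((2 * (i : ℝ) + 1) ^ 2))).coeff (m - 1 - x.2) * (4 ^ (m - 1 - x.2) * ((m - 1 - x.2).factorial : ℝ))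
        else ∑ k ∈ Finset.range m, (C (1 / (4 ^ (m - 1) * ((2 * m - 1).factorial : ℝ))) *
          ∏ i ∈ Finset.range (m - 1), (X - C ((2 * (i : ℝ) + 1) ^ 2))).coeff k * (((1 / 4 : ℝ) ^ (x.2 - m) - 2 ^ (2 * k + 1)) *
          ((-1 : ℝ) ^ (x.2 - m + 1) * (bernoulli (2 * (k + (x.2 - m) + 1)) : ℝ) /
            (2 * ((k + (x.2 - m) + 1 : ℕ) : ℝ) * ((x.2 - m).factorial : ℝ)))))) / 2)
          (fun n : Fin (m + N + 1) ↦ 1 * ((2 * (m : ℝ) - 1) * ∑ x ∈ Finset.HasAntidiagonal.antidiagonal (n : ℕ), ((2 * (m : ℝ) - 1) ^ 2 / 4) ^ x.1 / (x.1.factorial : ℝ) *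
        (if x.2 < m then (C (1 / (4 ^ (m - 1) * ((2 * m - 1).factorial : ℝ))) *
          ∏ i ∈ Finset.range (m - 1), (X - C ((2 * (i : ℝ) + 1) ^ 2))).coeff (m - 1 - x.2) * (4 ^ (m - 1 - x.2) * Real.Gamma (((m - 1 - x.2 : ℕ) : ℝ) + 1 / 2) / 2) else 0)) / 2) k : ℝ)) : ℂ) / (s + ((Sum.elim (fun n : Fin (m + N + 1) ↦ ((n : ℕ) : ℝ) - m) (fun n : Fin (m + N + 1) ↦ ((n : ℕ) : ℝ) - m + 1 / 2) k) : ℝ)) -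
          ({i : (Σ l : ℕ, Fin ((l + 2 * m - 1).choose (2 * m - 1))) | ((i.1 : ℝ) * (i.1 + 2 * m - 1)) = 0}.ncard : ℂ) / s +
        mellin (fun t : ℝ ↦ ((∑' i : {i : (Σ l : ℕ, Fin ((l + 2 * m - 1).choose (2 * m - 1))) | ((i.1 : ℝ) * (i.1 + 2 * m - 1)) ≠ 0},
            rexp (-(t * ((((i : (Σ l : ℕ, Fin ((l + 2 * m - 1).choose (2 * m - 1))))).1 : ℝ) * (((i : (Σ l : ℕ, Fin ((l + 2 * m - 1).choose (2 * m - 1))))).1 + 2 * m - 1)))) : ℝ) : ℂ) -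
          (Ioc 0 1).indicator (fun t : ℝ ↦ ((∑ k : Fin (m + N + 1) ⊕ Fin (m + N + 1), Sum.elim (fun n : Fin (m + N + 1) ↦ (∑ x ∈ Finset.HasAntidiagonal.antidiagonal (n : ℕ), ((2 * (m : ℝ) - 1) ^ 2 / 4) ^ x.1 / (x.1.factorial : ℝ) *
        (if x.2 < m then (C (1 / (4 ^ (m - 1) * ((2 * m - 1).factorial : ℝ))) *
          ∏ i ∈ Finset.range (m - 1), (X - C ((2 * (i : ℝ) + 1) ^ 2))).coeff (m - 1 - x.2) * (4 ^ (m - 1 - x.2) * ((m - 1 - x.2).factorial : ℝ))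
        else ∑ k ∈ Finset.range m, (C (1 / (4 ^ (m - 1) * ((2 * m - 1).factorial : ℝ))) *
          ∏ i ∈ Finset.range (m - 1), (X - C ((2 * (i : ℝ) + 1) ^ 2))).coeff k * (((1 / 4 : ℝ) ^ (x.2 - m) - 2 ^ (2 * k + 1)) *
          ((-1 : ℝ) ^ (x.2 - m + 1) * (bernoulli (2 * (k + (x.2 - m) + 1)) : ℝ) /
            (2 * ((k + (x.2 - m) + 1 : ℕ) : ℝ) * ((x.2 - m).factorial : ℝ)))))) / 2)
          (fun n : Fin (m + N + 1) ↦ 1 * ((2 * (m : ℝ) - 1) * ∑ x ∈ Finset.HasAntidiagonal.antidiagonal (n : ℕ), ((2 * (m : ℝ) - 1) ^ 2 / 4) ^ x.1 / (x.1.factorial : ℝ) *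
        (if x.2 < m then (C (1 / (4 ^ (m - 1) * ((2 * m - 1).factorial : ℝ))) *
          ∏ i ∈ Finset.range (m - 1), (X - C ((2 * (i : ℝ) + 1) ^ 2))).coeff (m - 1 - x.2) * (4 ^ (m - 1 - x.2) * Real.Gamma (((m - 1 - x.2 : ℕ) : ℝ) + 1 / 2) / 2) else 0)) / 2) k * t ^ (Sum.elim (fun n : Fin (m + N + 1) ↦ ((n : ℕ) : ℝ) - m) (fun n : Fin (m + N + 1) ↦ ((n : ℕ) : ℝ) - m + 1 / 2) k) : ℝ) : ℂ) - ({i : (Σ l : ℕ, Fin ((l + 2 * m - 1).choose (2 * m - 1))) | ((i.1 : ℝ) * (i.1 + 2 * m - 1)) = 0}.ncard : ℂ)) t) s))) (𝓝[≠] (((m : ℝ) - 1 / 2 : ℝ) : ℂ))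
      (𝓝 (1 / (4 * ((2 * m - 2).factorial : ℂ)))) := by
  have hs₀ : -((N : ℝ) + 1) < (m : ℝ) - 1 / 2 := by
    have hm1 : (1 : ℝ) ≤ m := by exact_mod_cast hm
    linarith [(N.cast_nonneg : (0 : ℝ) ≤ N)]
  have h := tendsto_sub_mul_continuation_nhdsNE (μ := fun i : (Σ l : ℕ, Fin ((l + 2 * m - 1).choose (2 * m - 1))) ↦ ((i.1 : ℝ) * (i.1 + 2 * m - 1)))
    (fun i ↦ by
      have hm1 : (1 : ℝ) ≤ m := by exact_mod_cast hm
      have hl : (0 : ℝ) ≤ (i.1 : ℝ) := Nat.cast_nonneg _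
      show (0 : ℝ) ≤ (i.1 : ℝ) * (i.1 + 2 * m - 1)
      nlinarith) (tendsto_neumannEvenHemisphere_cofinite_atTop m hm) (fun t ht ↦ summable_neumannEvenHemisphere m hm ht)
    (isBigO_neumannEvenHemisphere_heatTrace_expansion m hm N) hs₀
  have e : (Complex.Gamma (((m : ℝ) - 1 / 2 : ℝ) : ℂ))⁻¹ *
      ((∑ k : Fin (m + N + 1) ⊕ Fin (m + N + 1), if Sum.elim (fun n : Fin (m + N + 1) ↦ ((n : ℕ) : ℝ) - m) (fun n : Fin (m + N + 1) ↦ ((n : ℕ) : ℝ) - m + 1 / 2) k = -((m : ℝ) - 1 / 2) then (((Sum.elim (fun n : Fin (m + N + 1) ↦ (∑ x ∈ Finset.HasAntidiagonal.antidiagonal (n : ℕ), ((2 * (m : ℝ) - 1) ^ 2 / 4) ^ x.1 / (x.1.factorial : ℝ) *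
        (if x.2 < m then (C (1 / (4 ^ (m - 1) * ((2 * m - 1).factorial : ℝ))) *
          ∏ i ∈ Finset.range (m - 1), (X - C ((2 * (i : ℝ) + 1) ^ 2))).coeff (m - 1 - x.2) * (4 ^ (m - 1 - x.2) * ((m - 1 - x.2).factorial : ℝ))
        else ∑ k ∈ Finset.range m, (C (1 / (4 ^ (m - 1) * ((2 * m - 1).factorial : ℝ))) *
          ∏ i ∈ Finset.range (m - 1), (X - C ((2 * (i : ℝ) + 1) ^ 2))).coeff k * (((1 / 4 : ℝ) ^ (x.2 - m) - 2 ^ (2 * k + 1)) *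
          ((-1 : ℝ) ^ (x.2 - m + 1) * (bernoulli (2 * (k + (x.2 - m) + 1)) : ℝ) /
            (2 * ((k + (x.2 - m) + 1 : ℕ) : ℝ) * ((x.2 - m).factorial : ℝ)))))) / 2)
          (fun n : Fin (m + N + 1) ↦ 1 * ((2 * (m : ℝ) - 1) * ∑ x ∈ Finset.HasAntidiagonal.antidiagonal (n : ℕ), ((2 * (m : ℝ) - 1) ^ 2 / 4) ^ x.1 / (x.1.factorial : ℝ) *
        (if x.2 < m then (C (1 / (4 ^ (m - 1) * ((2 * m - 1).factorial : ℝ))) *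
          ∏ i ∈ Finset.range (m - 1), (X - C ((2 * (i : ℝ) + 1) ^ 2))).coeff (m - 1 - x.2) * (4 ^ (m - 1 - x.2) * Real.Gamma (((m - 1 - x.2 : ℕ) : ℝ) + 1 / 2) / 2) else 0)) / 2) k : ℝ)) : ℂ) else 0) -
        if (m : ℝ) - 1 / 2 = 0 then ({i : (Σ l : ℕ, Fin ((l + 2 * m - 1).choose (2 * m - 1))) | ((i.1 : ℝ) * (i.1 + 2 * m - 1)) = 0}.ncard : ℂ) else 0) = 1 / (4 * ((2 * m - 2).factorial : ℂ)) := by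
    rw [Fintype.sum_sum_type]
    simp only [Sum.elim_inl, Sum.elim_inr, natCast_sub_ne_neg_sub_half _ m, if_false, Finset.sum_const_zero, zero_add,
      evenHemisphereHalfExponent_eq_iff m (m + N + 1) (show 0 < m + N + 1 by omega) (-((m : ℝ) - 1 / 2)) (by push_cast; ring),
      Finset.sum_ite_eq', Finset.mem_univ, if_true, natCast_sub_half_ne_zero m, sub_zero, Complex.Gamma_ofReal]
    rw [evenHemisphere_boundaryCoeff_zero m hm, ← Complex.ofReal_inv, ← Complex.ofReal_mul,
      show (Real.Gamma ((m : ℝ) - 1 / 2))⁻¹ * (1 * (2 * √π / (4 ^ m * ((m - 1).factorial : ℝ))) / 2) =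
        (Real.Gamma ((m : ℝ) - 1 / 2))⁻¹ * (√π / (4 ^ m * ((m - 1).factorial : ℝ))) by ring,
      inv_Gamma_mul_sqrt_pi_div m hm]
    push_cast
    ring
  rw [e] at h
  exact h

end Literature.Analysis.InnerProduct
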